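import Literature.Analysis.FluidPDE.SteadyLiouvilleTsaiPressure
import Literature.Analysis.FluidPDE.SteadyLiouvilleCriteria
import Literature.Analysis.FluidPDE.TsaiGradientEstimate
import Literature.Analysis.FluidPDE.LerayProfileRegularity
import Literature.Analysis.FluidPDE.TsaiProfileL103
import Mathlib.Analysis.FunctionalSpaces.SobolevInequality
import HarnessLib

/-!
# Tsai's annular Liouville theorem (Tsai 2021, Thm 1.1 (a)) — IV: the energy endgame and the
# discharge `Tsai2021_annular_liouville_holds`

Analysis/FluidPDE proof file (theorems only: no definitions, no named facts) discharging the
named fact `Literature.Analysis.FluidPDE.Tsai2021_annular_liouville` of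
`SteadyLiouvilleCriteria.lean` (T.-P. Tsai, *Liouville type theorems for stationary
Navier–Stokes equations*, SN Partial Differ. Equ. Appl. 2 (2021), Paper No. 10 =
arXiv:2005.09691, Theorem 1.1 (a): `q = 6(3−δ)/(6−δ)`, `0 ≤ δ ≤ 1`, `β(δ,0) = −1/(3−δ)`), sequel of
`SteadyLiouvilleTsaiKit.lean`, `SteadyLiouvilleTsaiVorticity.lean` and
`SteadyLiouvilleTsaiPressure.lean` (which supply the pressure-independent local estimate,
Tsai's Lemma 3.2 / display (3.5), at a fixed ratio of radii).

This file follows §3 of the paper from display (3.6) on: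

* §8 pointwise tools (`|D(ζU)|² ≤ 2ζ²|DU|² + 2|U|²|Dζ|²`, with `‖L‖² ≤ |L|²_F` from
  `TsaiProfileL103.opNorm_sq_le_frobeniusNormSq_fin3`);
* §9 the cut-offs `ζ_R(x) = ζ₁(x/R)` (`= 1` on `|x| ≤ aR`, `= 0` on `|x| ≥ bR`, `|Dζ| ≤ K/R`,
  `|Δζ²| ≤ K/R²`);
* §10 the Hölder splittings with Tsai's exponents (`∫ζ|U|³ ≤ ‖ζU‖₆^δ ‖U‖_q^{3−δ}`,
  `∫ζ|P−c||U| ≤ ‖ζU‖₆^δ ‖P−c‖_{q/2} ‖U‖_q^{1−δ}`), valid for `δ ∈ [0,1]` including the endpoints;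
* §11 the Sobolev step `‖ζU‖₆² ≤ C_S²(2∫ζ²|DU|² + 2∫|U|²|Dζ|²)` (Mathlib's Gagliardo–Nirenberg–Sobolev
  inequality `eLpNorm_le_eLpNorm_fderiv_of_eq`);
* §12 the real inequalities: Young absorption of `‖ζU‖₆^δ` and the bookkeeping of all terms in
  the single quantity `Q = R⁻¹‖U‖_{L^q(R<|x|<LR)}^{3−δ}` for `R ≥ 1` ((3.7)–(3.8));
* §13 conversions between `∫⁻` on shells and real integrals;
* §14 `energy_estimate`: the energy identity of the tree (`IsLerayProfile.locEnergy`, tested with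
  `ζ²`) combined with §10–§13: `∫ ζ²|DU|² ≤ C (Q^{2/(3−δ)} + (Q + Q^{(2−δ)/(3−δ)})^{2/(2−δ)})`;
* §15 Tsai's quantity `tsaiAnnulusQuantity` in real form, and its growth `≳ R^{(4−δ)/2}` for a
  nonzero constant field;
* §16 the proof of Theorem 1.1 (a): along radii with `Q(R_k) → 0` the Dirichlet integral vanishes
  on every ball, so `DU ≡ 0`, `U` is constant, and the hypothesis forces `U ≡ 0`:
  `Tsai2021_annular_liouville_holds`.

## References

* T.-P. Tsai, *Liouville type theorems for stationary Navier–Stokes equations*, SN Partial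
  Differ. Equ. Appl. 2 (2021), Paper No. 10 (arXiv:2005.09691), Theorem 1.1 (a) and §3,
  displays (3.6)–(3.8). [Tsai2021]
* G. P. Galdi, *An introduction to the mathematical theory of the Navier–Stokes equations.
  Steady-state problems*, 2nd ed., Springer (2011), Thm X.9.5 (the case `q = 9/2`, and the
  `DU ≡ 0 ⇒ U ≡ 0` conclusion). [Galdi2011]
-/

noncomputable section

open MeasureTheory Set Filter Function Metric InnerProductSpace Topology
open scoped ENNReal NNReal RealInnerProductSpace Laplacian ContDiff Convolution

namespace Literature.Analysis.FluidPDE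

namespace Tsai2021

/-! ### §8. Pointwise tools for the energy estimate -/

section PointwiseTools

variable {ζ : (EuclideanSpace ℝ (Fin 3)) → ℝ} {U : (EuclideanSpace ℝ (Fin 3)) → (EuclideanSpace ℝ (Fin 3))}

/-- `D(ζ²)(x) v = 2 ζ(x) Dζ(x) v`. [folklore] -/
theorem fderiv_sq_apply (hζ : ContDiff ℝ 1 ζ) (x v : (EuclideanSpace ℝ (Fin 3))) :
    fderiv ℝ (fun y => ζ y ^ 2) x v = 2 * ζ x * fderiv ℝ ζ x v := by
  have h : (fun y => ζ y ^ 2) = fun y => ζ y * ζ y := funext fun y => sq (ζ y)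
  rw [h, pd_mul_apply hζ hζ x v]; ring

/-- `‖D(ζU)(x)‖² ≤ 2 ζ(x)² |DU(x)|²_F + 2 ‖U x‖² ‖Dζ(x)‖²`. [folklore] -/
theorem norm_fderiv_smul_sq_le (hζ : ContDiff ℝ 1 ζ) (hU : ContDiff ℝ 1 U) (x : (EuclideanSpace ℝ (Fin 3))) :
    ‖fderiv ℝ (fun y => ζ y • U y) x‖ ^ 2 ≤
      2 * (ζ x ^ 2 * frobeniusNormSq (fderiv ℝ U x)) + 2 * (‖U x‖ ^ 2 * ‖fderiv ℝ ζ x‖ ^ 2) := by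
  have hζd : DifferentiableAt ℝ ζ x := hζ.differentiable one_ne_zero x
  have hUd : DifferentiableAt ℝ U x := hU.differentiable one_ne_zero x
  rw [fderiv_fun_smul hζd hUd]
  have h1 : ‖ζ x • fderiv ℝ U x‖ ≤ |ζ x| * ‖fderiv ℝ U x‖ := by
    rw [norm_smul, Real.norm_eq_abs]
  have h2 : ‖(fderiv ℝ ζ x).smulRight (U x)‖ ≤ ‖fderiv ℝ ζ x‖ * ‖U x‖ :=
    ContinuousLinearMap.norm_smulRight_apply _ _ |>.le
  have hsum := norm_add_le (ζ x • fderiv ℝ U x) ((fderiv ℝ ζ x).smulRight (U x))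
  have hop := opNorm_sq_le_frobeniusNormSq_fin3 (fderiv ℝ U x)
  have ha : 0 ≤ |ζ x| * ‖fderiv ℝ U x‖ := by positivity
  have hb : 0 ≤ ‖fderiv ℝ ζ x‖ * ‖U x‖ := by positivity
  calc ‖ζ x • fderiv ℝ U x + (fderiv ℝ ζ x).smulRight (U x)‖ ^ 2
      ≤ (|ζ x| * ‖fderiv ℝ U x‖ + ‖fderiv ℝ ζ x‖ * ‖U x‖) ^ 2 := by
        gcongr; exact hsum.trans (add_le_add h1 h2)
    _ ≤ 2 * (|ζ x| * ‖fderiv ℝ U x‖) ^ 2 + 2 * (‖fderiv ℝ ζ x‖ * ‖U x‖) ^ 2 := by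
        nlinarith [sq_nonneg (|ζ x| * ‖fderiv ℝ U x‖ - ‖fderiv ℝ ζ x‖ * ‖U x‖)]
    _ ≤ 2 * (ζ x ^ 2 * frobeniusNormSq (fderiv ℝ U x)) + 2 * (‖U x‖ ^ 2 * ‖fderiv ℝ ζ x‖ ^ 2) := by
        rw [mul_pow, mul_pow, sq_abs]
        have h3 : ζ x ^ 2 * ‖fderiv ℝ U x‖ ^ 2 ≤ ζ x ^ 2 * frobeniusNormSq (fderiv ℝ U x) :=
          mul_le_mul_of_nonneg_left hop (sq_nonneg _)
        linarith [h3]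

end PointwiseTools

/-! ### §9. The family of cut-offs `ζ_R(x) = ζ₁(x/R)` -/

section CutoffFamily

/-- **Scaled radial cut-offs.** For `0 < a < b` there is `K ≥ 0` and, for every `R > 0`, a smooth
compactly supported `ζ : (EuclideanSpace ℝ (Fin 3)) → [0, 1]` with `ζ = 1` on `‖x‖ ≤ aR`, `ζ = 0` for `‖x‖ ≥ bR`,
`‖Dζ‖ ≤ K/R`, `|Δ(ζ²)| ≤ K/R²`, and `Dζ`, `Δ(ζ²)` supported in the shell `aR ≤ ‖x‖ ≤ bR`
(`ζ(x) = ζ₁(x/R)` for one bump `ζ₁`). [cite: Tsai2021, proof of Thm 1.1 (the cut-off ζ)] -/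
theorem exists_cutoff_family {a b : ℝ} (ha : 0 < a) (hab : a < b) :
    ∃ K : ℝ, 0 ≤ K ∧ ∀ R : ℝ, 0 < R → ∃ ζ : (EuclideanSpace ℝ (Fin 3)) → ℝ, ContDiff ℝ ∞ ζ ∧ HasCompactSupport ζ ∧
      (∀ x, 0 ≤ ζ x ∧ ζ x ≤ 1) ∧ (∀ x, ‖x‖ ≤ a * R → ζ x = 1) ∧ (∀ x, b * R ≤ ‖x‖ → ζ x = 0) ∧
      (∀ x, ‖fderiv ℝ ζ x‖ ≤ K / R) ∧ (∀ x, |(Δ (fun y => ζ y ^ 2)) x| ≤ K / R ^ 2) ∧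
      (∀ x, ¬ (a * R ≤ ‖x‖ ∧ ‖x‖ ≤ b * R) →
        fderiv ℝ ζ x = 0 ∧ (Δ (fun y => ζ y ^ 2)) x = 0) := by
  let φ : ContDiffBump (0 : (EuclideanSpace ℝ (Fin 3))) := ⟨a, b, ha, hab⟩
  set ζ₁ : (EuclideanSpace ℝ (Fin 3)) → ℝ := (φ : (EuclideanSpace ℝ (Fin 3)) → ℝ) with hζ₁
  have hζ₁s : ContDiff ℝ ∞ ζ₁ := φ.contDiff
  have hζ₁c : HasCompactSupport ζ₁ := φ.hasCompactSupport
  have hsq : ContDiff ℝ ∞ fun y => ζ₁ y ^ 2 := hζ₁s.pow 2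
  have hsqc : HasCompactSupport fun y => ζ₁ y ^ 2 := by
    have h : HasCompactSupport fun y => ζ₁ y * ζ₁ y := hζ₁c.mul_right
    simpa only [sq] using h
  obtain ⟨K₁, hK₁⟩ := ((hζ₁s.of_le (by norm_cast) : ContDiff ℝ 1 ζ₁).continuous_fderiv
    one_ne_zero).bounded_above_of_compact_support (hζ₁c.fderiv (𝕜 := ℝ))
  obtain ⟨K₂, hK₂⟩ := (continuous_laplacian (hsq.of_le (by norm_cast) : ContDiff ℝ 2 _)).bounded_above_of_compact_support
    (hasCompactSupport_laplacian hsqc)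
  refine ⟨max (max K₁ K₂) 0, le_max_right _ _, fun R hR => ?_⟩
  have hR0 : R ≠ 0 := hR.ne'
  have hRi : R⁻¹ ≠ 0 := inv_ne_zero hR0
  set ζ : (EuclideanSpace ℝ (Fin 3)) → ℝ := fun x => ζ₁ (R⁻¹ • x) with hζ
  have hζeq : ζ = fun x => (1 : ℝ) • ζ₁ (R⁻¹ • x) := by funext x; rw [one_smul]
  have hsqeq : (fun y => ζ y ^ 2) = fun x => (1 : ℝ) • ζ₁ (R⁻¹ • x) ^ 2 := by
    funext x; rw [one_smul]
  have hfd : ∀ x, fderiv ℝ ζ x = R⁻¹ • fderiv ℝ ζ₁ (R⁻¹ • x) := fun x => by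
    rw [hζeq, congrFun (fderiv_const_smul_comp_smul ζ₁ 1 hRi) x, one_mul]
  have hΔ : ∀ x, (Δ (fun y => ζ y ^ 2)) x = (R⁻¹) ^ 2 • (Δ (fun y => ζ₁ y ^ 2)) (R⁻¹ • x) := fun x => by
    rw [hsqeq, laplacian_const_smul_comp_smul (fun y => ζ₁ y ^ 2) 1 hRi x, one_mul]
  have hnorm : ∀ x : (EuclideanSpace ℝ (Fin 3)), ‖R⁻¹ • x‖ = ‖x‖ / R := fun x => by
    rw [norm_smul, norm_inv, Real.norm_of_nonneg hR.le, div_eq_inv_mul]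
  refine ⟨ζ, hζ₁s.comp (contDiff_const_smul R⁻¹), ?_, fun x => ⟨φ.nonneg, φ.le_one⟩,
    fun x hx => ?_, fun x hx => ?_, fun x => ?_, fun x => ?_, fun x hx => ?_⟩
  · -- compact support: `tsupport ζ ⊆ closedBall 0 (bR)`
    refine HasCompactSupport.intro (isCompact_closedBall (0 : (EuclideanSpace ℝ (Fin 3))) (b * R)) fun x hx => ?_
    rw [mem_closedBall_zero_iff, not_le] at hx
    exact φ.zero_of_le_dist (by rw [dist_zero_right, hnorm]; exact (le_div_iff₀ hR).2 hx.le)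
  · exact φ.one_of_mem_closedBall (by rw [mem_closedBall, dist_zero_right, hnorm]; exact (div_le_iff₀ hR).2 hx)
  · exact φ.zero_of_le_dist (by rw [dist_zero_right, hnorm]; exact (le_div_iff₀ hR).2 hx)
  · rw [hfd, norm_smul, norm_inv, Real.norm_of_nonneg hR.le, div_eq_inv_mul]
    gcongr
    exact (hK₁ _).trans (le_max_of_le_left (le_max_left _ _))
  · rw [hΔ, smul_eq_mul, abs_mul, abs_of_nonneg (by positivity), inv_pow, div_eq_inv_mul]
    gcongr
    rw [← Real.norm_eq_abs]
    exact (hK₂ _).trans (le_max_of_le_left (le_max_right _ _))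
  · -- off the shell `ζ` is locally constant
    have hcases : ‖x‖ < a * R ∨ b * R < ‖x‖ := by
      rcases lt_or_ge ‖x‖ (a * R) with h | h
      · exact Or.inl h
      · right
        by_contra h'
        exact hx ⟨h, not_lt.1 h'⟩
    have hloc : ∃ c : ℝ, ζ =ᶠ[𝓝 x] fun _ => c := by
      rcases hcases with h | h
      · refine ⟨1, ?_⟩
        have hball : ball (0 : (EuclideanSpace ℝ (Fin 3))) (a * R) ∈ 𝓝 x := isOpen_ball.mem_nhds (mem_ball_zero_iff.2 h)
        filter_upwards [hball] with y hy
        rw [mem_ball_zero_iff] at hy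
        exact φ.one_of_mem_closedBall (by
          rw [mem_closedBall, dist_zero_right, hnorm]; exact ((div_lt_iff₀ hR).2 hy).le)
      · refine ⟨0, ?_⟩
        have hopen : IsOpen {y : (EuclideanSpace ℝ (Fin 3)) | b * R < ‖y‖} := isOpen_lt continuous_const continuous_norm
        filter_upwards [hopen.mem_nhds h] with y hy
        exact φ.zero_of_le_dist (by rw [dist_zero_right, hnorm]; exact ((lt_div_iff₀ hR).2 hy).le)
    obtain ⟨c, hc⟩ := hloc
    have hc2 : (fun y => ζ y ^ 2) =ᶠ[𝓝 x] fun _ => c ^ 2 := hc.mono fun y hy => by simp only [hy]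
    refine ⟨?_, ?_⟩
    · rw [hc.fderiv_eq]; simp
    · rw [(laplacian_congr_nhds hc2).eq_of_nhds]
      exact laplacian_const_eq_zero (c ^ 2) x

end CutoffFamily

/-! ### §10. Hölder splittings with Tsai's exponents -/

section Holder

variable {μ : Measure (EuclideanSpace ℝ (Fin 3))}

/-- **Hölder for `I₂`**: with `q = 6(3−δ)/(6−δ)`,
`∫ (ζ|U|)^δ |U|^{3−δ} ≤ (∫ (ζ|U|)⁶)^{δ/6} (∫ |U|^q)^{(6−δ)/6}` (weights `δ/6 + (6−δ)/6 = 1`; the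
endpoint `δ = 0` is allowed). [cite: Tsai2021, proof of Thm 1.1 (Hölder and Sobolev inequalities)] -/
theorem lintegral_holder_I2 {δ : ℝ} (hδ0 : 0 ≤ δ) (hδ1 : δ ≤ 1) {F G : (EuclideanSpace ℝ (Fin 3)) → ℝ≥0∞}
    (hF : AEMeasurable F μ) (hG : AEMeasurable G μ) :
    ∫⁻ x, F x ^ δ * G x ^ (3 - δ) ∂μ ≤
      (∫⁻ x, F x ^ (6 : ℝ) ∂μ) ^ (δ / 6) * (∫⁻ x, G x ^ (6 * (3 - δ) / (6 - δ)) ∂μ) ^ ((6 - δ) / 6) := by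
  have h6 : (6 : ℝ) - δ ≠ 0 := by linarith
  have hw : δ / 6 + (6 - δ) / 6 = 1 := by ring
  have key := ENNReal.lintegral_mul_norm_pow_le (μ := μ) (f := fun x => F x ^ (6 : ℝ))
    (g := fun x => G x ^ (6 * (3 - δ) / (6 - δ))) (hF.pow_const _) (hG.pow_const _)
    (by positivity) (by linarith) hw
  refine le_trans (le_of_eq (lintegral_congr fun x => ?_)) key
  rw [← ENNReal.rpow_mul, ← ENNReal.rpow_mul]
  congr 2
  · ring
  · field_simp

/-- **Hölder for `I₃`**, first splitting: `∫ (ζ|U|)^δ H ≤ (∫(ζ|U|)⁶)^{δ/6} (∫ H^{6/(6−δ)})^{(6−δ)/6}`.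
[cite: Tsai2021, proof of Thm 1.1 (Hölder and Sobolev inequalities)] -/
theorem lintegral_holder_I3a {δ : ℝ} (hδ0 : 0 ≤ δ) (hδ1 : δ ≤ 1) {F H : (EuclideanSpace ℝ (Fin 3)) → ℝ≥0∞}
    (hF : AEMeasurable F μ) (hH : AEMeasurable H μ) :
    ∫⁻ x, F x ^ δ * H x ∂μ ≤
      (∫⁻ x, F x ^ (6 : ℝ) ∂μ) ^ (δ / 6) * (∫⁻ x, H x ^ (6 / (6 - δ)) ∂μ) ^ ((6 - δ) / 6) := by
  have h6 : (6 : ℝ) - δ ≠ 0 := by linarith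
  have hw : δ / 6 + (6 - δ) / 6 = 1 := by ring
  have key := ENNReal.lintegral_mul_norm_pow_le (μ := μ) (f := fun x => F x ^ (6 : ℝ))
    (g := fun x => H x ^ (6 / (6 - δ))) (hF.pow_const _) (hH.pow_const _)
    (by positivity) (by linarith) hw
  refine le_trans (le_of_eq (lintegral_congr fun x => ?_)) key
  rw [← ENNReal.rpow_mul, ← ENNReal.rpow_mul]
  have e1 : (6 : ℝ) * (δ / 6) = δ := by ring
  have e2 : (6 : ℝ) / (6 - δ) * ((6 - δ) / 6) = 1 := by field_simp
  rw [e1, e2, ENNReal.rpow_one]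

/-- **Hölder for `I₃`**, second splitting: with `s = 3(3−δ)/(6−δ)` and `q = 2s`,
`∫ (|P−c| |U|^{1−δ})^{6/(6−δ)} ≤ (∫|P−c|^s)^{2/(3−δ)} (∫|U|^q)^{(1−δ)/(3−δ)}` (weights
`2/(3−δ) + (1−δ)/(3−δ) = 1`; the endpoint `δ = 1` is allowed). [cite: Tsai2021, proof of Thm 1.1 (Hölder and Sobolev inequalities)] -/
theorem lintegral_holder_I3b {δ : ℝ} (hδ1 : δ ≤ 1) {Pf G : (EuclideanSpace ℝ (Fin 3)) → ℝ≥0∞}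
    (hPf : AEMeasurable Pf μ) (hG : AEMeasurable G μ) :
    ∫⁻ x, (Pf x * G x ^ (1 - δ)) ^ (6 / (6 - δ)) ∂μ ≤
      (∫⁻ x, Pf x ^ (3 * (3 - δ) / (6 - δ)) ∂μ) ^ (2 / (3 - δ)) *
        (∫⁻ x, G x ^ (6 * (3 - δ) / (6 - δ)) ∂μ) ^ ((1 - δ) / (3 - δ)) := by
  have h6 : (6 : ℝ) - δ ≠ 0 := by linarith
  have h3 : (3 : ℝ) - δ ≠ 0 := by linarith
  have hw : 2 / (3 - δ) + (1 - δ) / (3 - δ) = 1 := by field_simp; ring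
  have key := ENNReal.lintegral_mul_norm_pow_le (μ := μ) (f := fun x => Pf x ^ (3 * (3 - δ) / (6 - δ)))
    (g := fun x => G x ^ (6 * (3 - δ) / (6 - δ))) (hPf.pow_const _) (hG.pow_const _)
    (div_nonneg zero_le_two (by linarith)) (div_nonneg (by linarith) (by linarith)) hw
  refine le_trans (le_of_eq (lintegral_congr fun x => ?_)) key
  rw [ENNReal.mul_rpow_of_nonneg _ _ (div_nonneg (by norm_num) (by linarith)), ← ENNReal.rpow_mul,
    ← ENNReal.rpow_mul, ← ENNReal.rpow_mul]
  congr 2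
  · field_simp; norm_num
  · field_simp

end Holder

/-! ### §11. The Sobolev step: `‖ζU‖₆² ≤ C_S² ∫ |D(ζU)|² ≤ 2C_S² (∫ζ²|DU|² + ∫|U|²|Dζ|²)` -/

section Sobolev

variable {ζ : (EuclideanSpace ℝ (Fin 3)) → ℝ} {U : (EuclideanSpace ℝ (Fin 3)) → (EuclideanSpace ℝ (Fin 3))}

/-- `∫⁻ ofReal f = ofReal (∫ f)` for a nonnegative continuous compactly supported `f`. [folklore] -/
theorem lintegral_ofReal_eq_ofReal_integral {f : (EuclideanSpace ℝ (Fin 3)) → ℝ} (hf : Continuous f)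
    (hfc : HasCompactSupport f) (h0 : ∀ x, 0 ≤ f x) :
    ∫⁻ x, ENNReal.ofReal (f x) = ENNReal.ofReal (∫ x, f x) :=
  (ofReal_integral_eq_lintegral_ofReal (hf.integrable_of_hasCompactSupport hfc)
    (Eventually.of_forall h0)).symm

/-- **The Sobolev step** (Gagliardo–Nirenberg–Sobolev on `(EuclideanSpace ℝ (Fin 3))`, `p = 2`, `p* = 6`, Mathlib's
`eLpNorm_le_eLpNorm_fderiv_of_eq`): for a smooth compactly supported cut-off `ζ` and `U ∈ C¹`,
`‖ζU‖_{L⁶}² ≤ C_S² · 2 (∫ ζ²|DU|²_F + ∫ |U|²‖Dζ‖²)`. [cite: Tsai2021, proof of Thm 1.1 (Sobolev inequality for uζ)] -/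
theorem eLpNorm_six_sq_le (hζ : ContDiff ℝ ∞ ζ) (hζc : HasCompactSupport ζ) (hU : ContDiff ℝ ∞ U) :
    (eLpNorm (fun x => ζ x • U x) 6 volume).toReal ^ 2 ≤
      (SNormLESNormFDerivOfEqConst (EuclideanSpace ℝ (Fin 3)) (volume : Measure (EuclideanSpace ℝ (Fin 3))) 2 : ℝ) ^ 2 *
        (2 * (∫ x, ζ x ^ 2 * frobeniusNormSq (fderiv ℝ U x)) +
          2 * (∫ x, ‖U x‖ ^ 2 * ‖fderiv ℝ ζ x‖ ^ 2)) := by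
  have hζ1 : ContDiff ℝ 1 ζ := hζ.of_le (by norm_cast)
  have hU1 : ContDiff ℝ 1 U := hU.of_le (by norm_cast)
  have hV : ContDiff ℝ 1 fun x => ζ x • U x := (hζ.smul hU).of_le (by norm_cast)
  have hVc : HasCompactSupport fun x => ζ x • U x := hζc.smul_right
  -- GNS
  have hgns := MeasureTheory.eLpNorm_le_eLpNorm_fderiv_of_eq (μ := (volume : Measure (EuclideanSpace ℝ (Fin 3)))) (F := (EuclideanSpace ℝ (Fin 3))) hV hVc
    (p := 2) (p' := 6) one_le_two (by rw [finrank_euclideanSpace_fin]; norm_num)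
    (by rw [finrank_euclideanSpace_fin]; norm_num)
  -- the gradient integrand
  set Y : ℝ := ∫ x, ζ x ^ 2 * frobeniusNormSq (fderiv ℝ U x) with hY
  set Z : ℝ := ∫ x, ‖U x‖ ^ 2 * ‖fderiv ℝ ζ x‖ ^ 2 with hZ
  have hg : ∀ x, ‖fderiv ℝ (fun y => ζ y • U y) x‖ ^ 2 ≤
      2 * (ζ x ^ 2 * frobeniusNormSq (fderiv ℝ U x)) + 2 * (‖U x‖ ^ 2 * ‖fderiv ℝ ζ x‖ ^ 2) :=
    fun x => norm_fderiv_smul_sq_le hζ1 hU1 x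
  -- both majorants are continuous compactly supported and nonnegative
  have hcont1 : Continuous fun x => ζ x ^ 2 * frobeniusNormSq (fderiv ℝ U x) := by
    refine (hζ.continuous.pow 2).mul ?_
    have h := (hU1.continuous_fderiv one_ne_zero)
    simp only [frobeniusNormSq]
    exact continuous_finsetSum _ fun i _ => (h.clm_apply continuous_const).norm.pow 2
  have hcs1 : HasCompactSupport fun x => ζ x ^ 2 * frobeniusNormSq (fderiv ℝ U x) := by
    have : HasCompactSupport fun x => ζ x ^ 2 := by
      have h : HasCompactSupport fun y => ζ y * ζ y := hζc.mul_right
      simpa only [sq] using h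
    exact this.mul_right
  have hcont2 : Continuous fun x => ‖U x‖ ^ 2 * ‖fderiv ℝ ζ x‖ ^ 2 :=
    (hU.continuous.norm.pow 2).mul ((hζ1.continuous_fderiv one_ne_zero).norm.pow 2)
  have hcs2 : HasCompactSupport fun x => ‖U x‖ ^ 2 * ‖fderiv ℝ ζ x‖ ^ 2 := by
    have h1 : HasCompactSupport fun x => ‖fderiv ℝ ζ x‖ ^ 2 := by
      have h : HasCompactSupport fun x => ‖fderiv ℝ ζ x‖ * ‖fderiv ℝ ζ x‖ :=
        (hζc.fderiv (𝕜 := ℝ)).norm.mul_right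
      simpa only [sq] using h
    exact h1.mul_left
  have hnn1 : ∀ x, 0 ≤ ζ x ^ 2 * frobeniusNormSq (fderiv ℝ U x) := fun x =>
    mul_nonneg (sq_nonneg _) (frobeniusNormSq_nonneg _)
  have hnn2 : ∀ x, 0 ≤ ‖U x‖ ^ 2 * ‖fderiv ℝ ζ x‖ ^ 2 := fun x => by positivity
  have hY0 : 0 ≤ Y := integral_nonneg hnn1
  have hZ0 : 0 ≤ Z := integral_nonneg hnn2
  -- `∫⁻ ‖D(ζU)‖ₑ² ≤ ofReal (2Y + 2Z)`
  have hgrad : ∫⁻ x, ‖fderiv ℝ (fun y => ζ y • U y) x‖ₑ ^ (2 : ℝ) ≤ ENNReal.ofReal (2 * Y + 2 * Z) := by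
    have hcont12 : Continuous fun x => 2 * (ζ x ^ 2 * frobeniusNormSq (fderiv ℝ U x)) +
        2 * (‖U x‖ ^ 2 * ‖fderiv ℝ ζ x‖ ^ 2) :=
      (continuous_const.mul hcont1).add (continuous_const.mul hcont2)
    have hcs12 : HasCompactSupport fun x => 2 * (ζ x ^ 2 * frobeniusNormSq (fderiv ℝ U x)) +
        2 * (‖U x‖ ^ 2 * ‖fderiv ℝ ζ x‖ ^ 2) := by
      have h1 : HasCompactSupport fun x => 2 * (ζ x ^ 2 * frobeniusNormSq (fderiv ℝ U x)) :=
        hcs1.mul_left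
      have h2 : HasCompactSupport fun x => 2 * (‖U x‖ ^ 2 * ‖fderiv ℝ ζ x‖ ^ 2) := hcs2.mul_left
      exact h1.add h2
    have hsum : ∫⁻ x, ENNReal.ofReal (2 * (ζ x ^ 2 * frobeniusNormSq (fderiv ℝ U x)) +
        2 * (‖U x‖ ^ 2 * ‖fderiv ℝ ζ x‖ ^ 2)) = ENNReal.ofReal (2 * Y + 2 * Z) := by
      rw [lintegral_ofReal_eq_ofReal_integral hcont12 hcs12 (fun x => by linarith [hnn1 x, hnn2 x])]
      congr 1
      rw [integral_add ((hcont1.integrable_of_hasCompactSupport hcs1).const_mul 2)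
        ((hcont2.integrable_of_hasCompactSupport hcs2).const_mul 2), integral_const_mul,
        integral_const_mul]
    rw [← hsum]
    refine lintegral_mono fun x => ?_
    rw [← ofReal_norm, ENNReal.ofReal_rpow_of_nonneg (norm_nonneg _) zero_le_two, Real.rpow_two]
    exact ENNReal.ofReal_le_ofReal (hg x)
  -- combine with GNS
  have h2 : eLpNorm (fderiv ℝ fun y => ζ y • U y) 2 volume ≤ ENNReal.ofReal (2 * Y + 2 * Z) ^ (1 / 2 : ℝ) := by
    rw [eLpNorm_eq_lintegral_rpow_enorm_toReal two_ne_zero ENNReal.ofNat_ne_top, ENNReal.toReal_ofNat]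
    exact ENNReal.rpow_le_rpow hgrad (by norm_num)
  set C : ℝ≥0 := SNormLESNormFDerivOfEqConst (EuclideanSpace ℝ (Fin 3)) (volume : Measure (EuclideanSpace ℝ (Fin 3))) 2 with hC
  have hW : eLpNorm (fun x => ζ x • U x) 6 volume ≤ C * ENNReal.ofReal (2 * Y + 2 * Z) ^ (1 / 2 : ℝ) := by
    have h1 : eLpNorm (fun x => ζ x • U x) 6 volume ≤ C * eLpNorm (fderiv ℝ fun y => ζ y • U y) 2 volume := by
      exact_mod_cast hgns
    exact h1.trans (mul_le_mul' le_rfl h2)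
  have hfin : (C : ℝ≥0∞) * ENNReal.ofReal (2 * Y + 2 * Z) ^ (1 / 2 : ℝ) ≠ ⊤ :=
    ENNReal.mul_ne_top ENNReal.coe_ne_top (ENNReal.rpow_ne_top_of_nonneg (by norm_num) ENNReal.ofReal_ne_top)
  have hWr : (eLpNorm (fun x => ζ x • U x) 6 volume).toReal ≤ C * (2 * Y + 2 * Z) ^ (1 / 2 : ℝ) := by
    have := ENNReal.toReal_mono hfin hW
    rwa [ENNReal.toReal_mul, ENNReal.coe_toReal, ← ENNReal.toReal_rpow, ENNReal.toReal_ofReal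
      (by linarith)] at this
  have hW0 : 0 ≤ (eLpNorm (fun x => ζ x • U x) 6 volume).toReal := ENNReal.toReal_nonneg
  show (eLpNorm (fun x => ζ x • U x) 6 volume).toReal ^ 2 ≤ (C : ℝ) ^ 2 * (2 * Y + 2 * Z)
  calc (eLpNorm (fun x => ζ x • U x) 6 volume).toReal ^ 2
      ≤ ((C : ℝ) * (2 * Y + 2 * Z) ^ (1 / 2 : ℝ)) ^ 2 := by gcongr
    _ = (C : ℝ) ^ 2 * (2 * Y + 2 * Z) := by
        rw [mul_pow, ← Real.rpow_natCast ((2 * Y + 2 * Z) ^ (1 / 2 : ℝ)) 2, ← Real.rpow_mul (by linarith)]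
        norm_num

end Sobolev

/-! ### §12. Real inequalities: Young absorption and the bookkeeping in `Q = R⁻¹X^{3−δ}` -/

section RealIneq

/-- **Young/AM–GM absorption** (Tsai 2021, proof of Thm 1.1, the step "By Young's inequality
`|I₂+I₃| ≤ ½‖∇(uζ)‖₂² + CJ^{1/(1−δ/2)}`"): if `νy ≤ i + w^δ m` and `w² ≤ c_S(2y + 2z)` with
`0 ≤ δ ≤ 1`, then `y ≤ (4/3ν) i + z/3 + (4/3ν) κ^{−δ/(2−δ)} m^{2/(2−δ)}`, `κ = ν/(4c_S + 4)`
(weighted AM–GM with weights `δ/2`, `(2−δ)/2`; the endpoints `δ = 0, 1` are allowed).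
[cite: Tsai2021, proof of Thm 1.1 (Young's inequality)] -/
theorem absorb {ν δ y z i w m cS : ℝ} (hν : 0 < ν) (hδ0 : 0 ≤ δ) (hδ1 : δ ≤ 1) (hy : 0 ≤ y)
    (hz : 0 ≤ z) (hw : 0 ≤ w) (hm : 0 ≤ m) (hcS : 0 ≤ cS) (h1 : ν * y ≤ i + w ^ δ * m)
    (h2 : w ^ (2 : ℕ) ≤ cS * (2 * y + 2 * z)) :
    y ≤ 4 / (3 * ν) * i + z / 3 +
      4 / (3 * ν) * ((ν / (4 * cS + 4)) ^ (-(δ / (2 - δ))) * m ^ (2 / (2 - δ))) := by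
  set κ : ℝ := ν / (4 * cS + 4) with hκ
  have hκ0 : 0 < κ := by rw [hκ]; positivity
  have h2δ : 0 < 2 - δ := by linarith
  -- the two numbers and weights of the AM–GM inequality
  set p₁ : ℝ := κ * w ^ (2 : ℕ) with hp₁
  set p₂ : ℝ := (κ ^ (-(δ / 2)) * m) ^ (2 / (2 - δ)) with hp₂
  have hp₁0 : 0 ≤ p₁ := by rw [hp₁]; positivity
  have hb0 : 0 ≤ κ ^ (-(δ / 2)) * m := mul_nonneg (Real.rpow_nonneg hκ0.le _) hm
  have hp₂0 : 0 ≤ p₂ := by rw [hp₂]; exact Real.rpow_nonneg hb0 _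
  have hprod : w ^ δ * m = p₁ ^ (δ / 2) * p₂ ^ ((2 - δ) / 2) := by
    rw [hp₁, hp₂, ← Real.rpow_mul hb0, show 2 / (2 - δ) * ((2 - δ) / 2) = 1 by field_simp,
      Real.rpow_one, Real.mul_rpow hκ0.le (by positivity), ← Real.rpow_natCast w 2,
      ← Real.rpow_mul hw, show ((2 : ℕ) : ℝ) * (δ / 2) = δ by push_cast; ring]
    have hk : κ ^ (δ / 2) * κ ^ (-(δ / 2)) = 1 := by
      rw [← Real.rpow_add hκ0, add_neg_cancel, Real.rpow_zero]
    calc w ^ δ * m = (κ ^ (δ / 2) * κ ^ (-(δ / 2))) * (w ^ δ * m) := by rw [hk, one_mul]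
      _ = κ ^ (δ / 2) * w ^ δ * (κ ^ (-(δ / 2)) * m) := by ring
  have hamgm := Real.geom_mean_le_arith_mean2_weighted (w₁ := δ / 2) (w₂ := (2 - δ) / 2)
    (by positivity) (by positivity) hp₁0 hp₂0 (by ring)
  rw [← hprod] at hamgm
  -- `δ/2 · p₁ ≤ ½ κ w² ≤ (ν/4)(y+z)`
  have hκcS : κ * cS ≤ ν / 4 := by
    rw [hκ, div_mul_eq_mul_div, div_le_div_iff₀ (by positivity) (by norm_num)]
    nlinarith
  have hA : δ / 2 * p₁ ≤ ν / 4 * (y + z) := by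
    have h3 : p₁ ≤ κ * (cS * (2 * y + 2 * z)) := by
      rw [hp₁]; exact mul_le_mul_of_nonneg_left h2 hκ0.le
    have h4 : δ / 2 * p₁ ≤ 1 / 2 * p₁ := by nlinarith
    nlinarith [mul_nonneg hcS (by linarith : (0:ℝ) ≤ 2 * y + 2 * z)]
  have hB : (2 - δ) / 2 * p₂ ≤ p₂ := by
    have : (2 - δ) / 2 ≤ 1 := by rw [div_le_one (by norm_num)]; linarith
    exact mul_le_of_le_one_left hp₂0 this
  have hp₂' : p₂ = κ ^ (-(δ / (2 - δ))) * m ^ (2 / (2 - δ)) := by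
    rw [hp₂, Real.mul_rpow (Real.rpow_nonneg hκ0.le _) hm, ← Real.rpow_mul hκ0.le]
    congr 2
    field_simp
  -- collect
  have hmain : ν * y ≤ i + ν / 4 * (y + z) + p₂ := by linarith
  have h34 : 3 * ν / 4 * y ≤ i + ν / 4 * z + p₂ := by linarith
  rw [← hp₂', hκ] at *
  have hν' : 0 < 3 * ν := by positivity
  rw [show 4 / (3 * ν) * i + z / 3 + 4 / (3 * ν) * p₂ = (4 * i + ν * z + 4 * p₂) / (3 * ν) by
    field_simp]
  rw [le_div_iff₀ hν']
  linarith

/-- The exponent identities of Tsai's bookkeeping: with `q = 6(3−δ)/(6−δ)`,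
`1 − 6/q = −3/(3−δ)` and `3/q − 2 + (2−δ)/(3−δ) = (δ−2)/(2(3−δ))`. [cite: Tsai2021, proof of Thm 1.1 (definition of β(δ, α))] -/
theorem exponent_identities {δ : ℝ} (hδ1 : δ ≤ 1) :
    1 - 6 / (6 * (3 - δ) / (6 - δ)) = -3 / (3 - δ) ∧
      3 / (6 * (3 - δ) / (6 - δ)) - 2 + (2 - δ) / (3 - δ) = (δ - 2) / (2 * (3 - δ)) := by
  have h3 : (3 : ℝ) - δ ≠ 0 := by linarith
  have h6 : (6 : ℝ) - δ ≠ 0 := by linarith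
  constructor
  · field_simp; ring
  · field_simp; ring

/-- **Bookkeeping in `Q = R⁻¹X^{3−δ}`, (a)**: for `R ≥ 1`, `X ≥ 0`,
`R^{1−6/q} X² ≤ (R⁻¹X^{3−δ})^{2/(3−δ)}` (`= R^{−1/(3−δ)} Q^{2/(3−δ)}`). [cite: Tsai2021, proof of Thm 1.1 ((3.6)–(3.8))] -/
theorem bookkeeping_a {δ R X : ℝ} (hδ1 : δ ≤ 1) (hR : 1 ≤ R) (hX : 0 ≤ X) :
    R ^ (1 - 6 / (6 * (3 - δ) / (6 - δ))) * X ^ (2 : ℝ) ≤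
      (R⁻¹ * X ^ (3 - δ)) ^ (2 / (3 - δ)) := by
  have hR0 : 0 < R := by linarith
  have h3 : 0 < 3 - δ := by linarith
  rw [(exponent_identities hδ1).1, ← Real.rpow_neg_one R,
    Real.mul_rpow (Real.rpow_nonneg hR0.le _) (Real.rpow_nonneg hX _), ← Real.rpow_mul hR0.le,
    ← Real.rpow_mul hX, show (3 - δ) * (2 / (3 - δ)) = 2 by field_simp]
  refine mul_le_mul_of_nonneg_right (Real.rpow_le_rpow_of_exponent_le hR ?_) (Real.rpow_nonneg hX _)
  rw [neg_one_mul, neg_div, neg_le_neg_iff, div_le_div_iff_of_pos_right h3]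
  norm_num

/-- **Bookkeeping in `Q = R⁻¹X^{3−δ}`, (b)**: for `R ≥ 1`, `X ≥ 0`,
`R^{3/q−2} X^{2−δ} ≤ (R⁻¹X^{3−δ})^{(2−δ)/(3−δ)}` (`= R^{(δ−2)/(2(3−δ))} Q^{(2−δ)/(3−δ)}`).
[cite: Tsai2021, proof of Thm 1.1 ((3.6)–(3.8))] -/
theorem bookkeeping_b {δ R X : ℝ} (hδ1 : δ ≤ 1) (hR : 1 ≤ R) (hX : 0 ≤ X) :
    R ^ (3 / (6 * (3 - δ) / (6 - δ)) - 2) * X ^ (2 - δ) ≤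
      (R⁻¹ * X ^ (3 - δ)) ^ ((2 - δ) / (3 - δ)) := by
  have hR0 : 0 < R := by linarith
  have h3 : 0 < 3 - δ := by linarith
  have hid := (exponent_identities hδ1).2
  rw [← Real.rpow_neg_one R, Real.mul_rpow (Real.rpow_nonneg hR0.le _) (Real.rpow_nonneg hX _),
    ← Real.rpow_mul hR0.le, ← Real.rpow_mul hX,
    show (3 - δ) * ((2 - δ) / (3 - δ)) = 2 - δ by field_simp]
  refine mul_le_mul_of_nonneg_right (Real.rpow_le_rpow_of_exponent_le hR ?_) (Real.rpow_nonneg hX _)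
  have e : 3 / (6 * (3 - δ) / (6 - δ)) - 2 = (δ - 2) / (2 * (3 - δ)) - (2 - δ) / (3 - δ) := by
    linarith
  rw [e, neg_one_mul, sub_le_iff_le_add, show -((2 - δ) / (3 - δ)) + (2 - δ) / (3 - δ) = 0 by ring]
  exact div_nonpos_of_nonpos_of_nonneg (by linarith) (by linarith)

end RealIneq

/-! ### §13. Measure-theoretic conversions on shells -/

section Conversions

variable {U : (EuclideanSpace ℝ (Fin 3)) → (EuclideanSpace ℝ (Fin 3))}

/-- The closed shell is compact. [folklore] -/
theorem isCompact_shell_closed (a b : ℝ) : IsCompact {x : (EuclideanSpace ℝ (Fin 3)) | a ≤ ‖x‖ ∧ ‖x‖ ≤ b} :=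
  Metric.isCompact_of_isClosed_isBounded
    ((isClosed_Icc.preimage continuous_norm : IsClosed ((fun x : (EuclideanSpace ℝ (Fin 3)) => ‖x‖) ⁻¹' Icc a b)))
    (isBounded_closedBall.subset fun _ hx => mem_closedBall_zero_iff.2 hx.2)

/-- `∫⁻_{s} ‖f‖ₑ^r < ∞` for continuous `f`, `r ≥ 0`, on a set inside a closed ball. [folklore] -/
theorem setLIntegral_enorm_rpow_lt_top {F : Type*} [NormedAddCommGroup F] {U : (EuclideanSpace ℝ (Fin 3)) → F}
    (hU : Continuous U) {r : ℝ} (hr : 0 ≤ r) {s : Set (EuclideanSpace ℝ (Fin 3))}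
    {ρ : ℝ} (hs : s ⊆ closedBall (0 : (EuclideanSpace ℝ (Fin 3))) ρ) : ∫⁻ x in s, ‖U x‖ₑ ^ r < ⊤ := by
  have hcont : Continuous fun x => ‖U x‖ ^ r := hU.norm.rpow_const fun _ => Or.inr hr
  have hint : IntegrableOn (fun x => ‖U x‖ ^ r) (closedBall (0 : (EuclideanSpace ℝ (Fin 3))) ρ) :=
    hcont.continuousOn.integrableOn_compact (isCompact_closedBall 0 ρ)
  have h2 := (hint.mono_set hs).2
  simp only [HasFiniteIntegral] at h2
  refine lt_of_le_of_lt (le_of_eq (lintegral_congr fun x => ?_)) h2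
  rw [Real.enorm_eq_ofReal (Real.rpow_nonneg (norm_nonneg _) _), ← ofReal_norm,
    ENNReal.ofReal_rpow_of_nonneg (norm_nonneg _) hr]

/-- A real set integral of a nonnegative continuous function as a lintegral. [folklore] -/
theorem setIntegral_eq_toReal_lintegral {f : (EuclideanSpace ℝ (Fin 3)) → ℝ} (hf : Continuous f) (h0 : ∀ x, 0 ≤ f x)
    {s : Set (EuclideanSpace ℝ (Fin 3))} : ∫ x in s, f x = (∫⁻ x in s, ENNReal.ofReal (f x)).toReal :=
  integral_eq_lintegral_of_nonneg_ae (Eventually.of_forall h0) hf.aestronglyMeasurable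

/-- `∫⁻_A ‖U‖ₑ² ≤ vol(A)^{1−2/q} (∫⁻_A ‖U‖ₑ^q)^{2/q}` for `q ≥ 2` (Hölder with the constant `1`).
[folklore] -/
theorem lintegral_sq_le_vol_rpow (hU : Continuous U) {q : ℝ} (hq : 2 ≤ q) (A : Set (EuclideanSpace ℝ (Fin 3))) :
    ∫⁻ x in A, ‖U x‖ₑ ^ (2 : ℝ) ≤
      (volume A) ^ (1 - 2 / q) * (∫⁻ x in A, ‖U x‖ₑ ^ q) ^ (2 / q) := by
  have hq0 : 0 < q := by linarith
  have key := ENNReal.lintegral_mul_norm_pow_le (μ := volume.restrict A) (f := fun _ => (1 : ℝ≥0∞))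
    (g := fun x => ‖U x‖ₑ ^ q) aemeasurable_const
    ((hU.measurable.enorm.pow_const q).aemeasurable) (p := 1 - 2 / q) (q := 2 / q)
    (by rw [sub_nonneg, div_le_one hq0]; exact hq) (by positivity) (by ring)
  simp only [ENNReal.one_rpow, one_mul, lintegral_const, Measure.restrict_apply_univ, one_mul] at key
  refine le_trans (le_of_eq (lintegral_congr fun x => ?_)) key
  rw [← ENNReal.rpow_mul]; congr 1; field_simp

end Conversions

/-! ### §13b. The three Hölder conversions and the pressure bound in real form -/

section RealBounds

variable {δ : ℝ} {U : (EuclideanSpace ℝ (Fin 3)) → (EuclideanSpace ℝ (Fin 3))} {P : (EuclideanSpace ℝ (Fin 3)) → ℝ} {ζ : (EuclideanSpace ℝ (Fin 3)) → ℝ} {A KR : Set (EuclideanSpace ℝ (Fin 3))} {ρ c : ℝ}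

/-- `ζ ≤ ζ^δ` on `[0, 1]` for `δ ≤ 1`. [folklore] -/
theorem le_rpow_of_le_one {t : ℝ} (h0 : 0 ≤ t) (h1 : t ≤ 1) (hδ1 : δ ≤ 1) : t ≤ t ^ δ := by
  rcases h0.eq_or_lt with h | h
  · rw [← h]; exact Real.rpow_nonneg le_rfl _
  · conv_lhs => rw [← Real.rpow_one t]
    exact Real.rpow_le_rpow_of_exponent_ge h h1 hδ1

/-- **`∫_A |U|² ≤ vol(A)^{1−2/q} ‖U‖²_{L^q(KR)}`** in real form (`q ≥ 2`, `A ⊆ KR` bounded).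
[folklore] -/
theorem IA_bound (hU : Continuous U) {q : ℝ} (hq2 : 2 ≤ q) (hAKR : A ⊆ KR)
    (hKR : KR ⊆ closedBall (0 : (EuclideanSpace ℝ (Fin 3))) ρ) {V : ℝ≥0∞} (hV : volume A ≤ V) (hVtop : V ≠ ⊤) :
    ∫ x in A, ‖U x‖ ^ 2 ≤
      V.toReal ^ (1 - 2 / q) * ((∫⁻ x in KR, ‖U x‖ₑ ^ q).toReal ^ (1 / q)) ^ (2 : ℝ) := by
  have hq0 : 0 < q := by linarith
  have h2q : 0 ≤ 1 - 2 / q := by rw [sub_nonneg, div_le_one hq0]; exact hq2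
  have hEtop : ∫⁻ x in KR, ‖U x‖ₑ ^ q < ⊤ := setLIntegral_enorm_rpow_lt_top hU hq0.le hKR
  have hofReal2 : ∀ y : (EuclideanSpace ℝ (Fin 3)), ENNReal.ofReal (‖U y‖ ^ 2) = ‖U y‖ₑ ^ (2 : ℝ) := fun y => by
    rw [← ofReal_norm, ENNReal.ofReal_rpow_of_nonneg (norm_nonneg _) zero_le_two, Real.rpow_two]
  have hIAe : ∫ x in A, ‖U x‖ ^ 2 = (∫⁻ y in A, ‖U y‖ₑ ^ (2 : ℝ)).toReal := by
    rw [setIntegral_eq_toReal_lintegral (f := fun y => ‖U y‖ ^ 2) (hU.norm.pow 2) fun y => sq_nonneg _]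
    congr 1; exact lintegral_congr fun y => hofReal2 y
  have hfin : V ^ (1 - 2 / q) * (∫⁻ x in KR, ‖U x‖ₑ ^ q) ^ (2 / q) ≠ ⊤ :=
    ENNReal.mul_ne_top (ENNReal.rpow_ne_top_of_nonneg h2q hVtop)
      (ENNReal.rpow_ne_top_of_nonneg (by positivity) hEtop.ne)
  have hle : ∫⁻ y in A, ‖U y‖ₑ ^ (2 : ℝ) ≤ V ^ (1 - 2 / q) * (∫⁻ x in KR, ‖U x‖ₑ ^ q) ^ (2 / q) := by
    refine (lintegral_sq_le_vol_rpow hU hq2 A).trans ?_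
    have hmono : ∫⁻ x in A, ‖U x‖ₑ ^ q ≤ ∫⁻ x in KR, ‖U x‖ₑ ^ q := lintegral_mono_set hAKR
    gcongr
  have := ENNReal.toReal_mono hfin hle
  rw [ENNReal.toReal_mul, ← ENNReal.toReal_rpow, ← ENNReal.toReal_rpow] at this
  rw [hIAe, ← Real.rpow_mul ENNReal.toReal_nonneg, show 1 / q * 2 = 2 / q by
    rw [one_div, inv_mul_eq_div]]
  exact this

/-- **`∫_A ζ|U|³ ≤ ‖ζU‖₆^δ ‖U‖^{3−δ}_{L^q(KR)}`** in real form (Hölder `lintegral_holder_I2`,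
`ζ ≤ ζ^δ`). [cite: Tsai2021, proof of Thm 1.1 (Hölder for I₂)] -/
theorem I2_bound (hδ0 : 0 ≤ δ) (hδ1 : δ ≤ 1) (hU : Continuous U) (hζ : Continuous ζ)
    (hζc : HasCompactSupport ζ) (h01 : ∀ x, 0 ≤ ζ x ∧ ζ x ≤ 1) (hAKR : A ⊆ KR)
    (hKR : KR ⊆ closedBall (0 : (EuclideanSpace ℝ (Fin 3))) ρ) :
    ∫ x in A, ζ x * ‖U x‖ ^ 3 ≤
      ((∫⁻ y, ‖ζ y • U y‖ₑ ^ (6 : ℝ)).toReal ^ (1 / 6 : ℝ)) ^ δ *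
        ((∫⁻ x in KR, ‖U x‖ₑ ^ (6 * (3 - δ) / (6 - δ))).toReal ^ (1 / (6 * (3 - δ) / (6 - δ)))) ^ (3 - δ) := by
  have h6 : 0 < 6 - δ := by linarith
  have h3 : 0 < 3 - δ := by linarith
  generalize hq' : 6 * (3 - δ) / (6 - δ) = q
  have hq0 : 0 < q := by rw [← hq']; positivity
  have h3q : (3 - δ) / q = (6 - δ) / 6 := by rw [← hq']; field_simp
  have hEtop : ∫⁻ x in KR, ‖U x‖ₑ ^ q < ⊤ := setLIntegral_enorm_rpow_lt_top hU hq0.le hKR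
  have hmemLp : MemLp (fun y => ζ y • U y) 6 volume := (hζ.smul hU).memLp_of_hasCompactSupport hζc.smul_right
  have hW6eq : eLpNorm (fun y => ζ y • U y) 6 volume = (∫⁻ y, ‖ζ y • U y‖ₑ ^ (6 : ℝ)) ^ (1 / 6 : ℝ) := by
    rw [eLpNorm_eq_lintegral_rpow_enorm_toReal (by norm_num) ENNReal.ofNat_ne_top, ENNReal.toReal_ofNat]
  have hW6top : (∫⁻ y, ‖ζ y • U y‖ₑ ^ (6 : ℝ)) ≠ ⊤ := by
    intro h
    have := hmemLp.eLpNorm_lt_top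
    rw [hW6eq, h, ENNReal.top_rpow_of_pos (by norm_num)] at this
    exact lt_irrefl _ this
  have hFeq : ∀ y, ‖ζ y • U y‖ₑ = ENNReal.ofReal (ζ y) * ‖U y‖ₑ := fun y => by
    rw [enorm_smul, Real.enorm_eq_ofReal (h01 y).1]
  have hFm : AEMeasurable (fun y => ‖ζ y • U y‖ₑ) (volume.restrict A) :=
    (hζ.smul hU).measurable.enorm.aemeasurable
  have hGm : AEMeasurable (fun y => ‖U y‖ₑ) (volume.restrict A) := hU.measurable.enorm.aemeasurable
  have hpt : ∀ y, ENNReal.ofReal (ζ y * ‖U y‖ ^ 3) ≤ ‖ζ y • U y‖ₑ ^ δ * ‖U y‖ₑ ^ (3 - δ) := by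
    intro y
    have hreal : ζ y * ‖U y‖ ^ 3 ≤ (ζ y * ‖U y‖) ^ δ * ‖U y‖ ^ (3 - δ) := by
      have e3 : ‖U y‖ ^ (3 : ℝ) = ‖U y‖ ^ (3 : ℕ) := by exact_mod_cast Real.rpow_natCast ‖U y‖ 3
      rw [Real.mul_rpow (h01 y).1 (norm_nonneg _), mul_assoc,
        ← Real.rpow_add' (norm_nonneg _) (by norm_num : δ + (3 - δ) ≠ 0),
        show δ + (3 - δ) = 3 by ring, e3]
      exact mul_le_mul_of_nonneg_right (le_rpow_of_le_one (h01 y).1 (h01 y).2 hδ1)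
        (pow_nonneg (norm_nonneg _) _)
    calc ENNReal.ofReal (ζ y * ‖U y‖ ^ 3) ≤ ENNReal.ofReal ((ζ y * ‖U y‖) ^ δ * ‖U y‖ ^ (3 - δ)) :=
          ENNReal.ofReal_le_ofReal hreal
      _ = ‖ζ y • U y‖ₑ ^ δ * ‖U y‖ₑ ^ (3 - δ) := by
          rw [ENNReal.ofReal_mul (Real.rpow_nonneg (mul_nonneg (h01 y).1 (norm_nonneg _)) _),
            ← ENNReal.ofReal_rpow_of_nonneg (mul_nonneg (h01 y).1 (norm_nonneg _)) hδ0,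
            ← ENNReal.ofReal_rpow_of_nonneg (norm_nonneg _) h3.le, ENNReal.ofReal_mul (h01 y).1,
            ofReal_norm, hFeq]
  have hH : ∫⁻ y in A, ENNReal.ofReal (ζ y * ‖U y‖ ^ 3) ≤
      (∫⁻ y, ‖ζ y • U y‖ₑ ^ (6 : ℝ)) ^ (δ / 6) * (∫⁻ x in KR, ‖U x‖ₑ ^ q) ^ ((6 - δ) / 6) := by
    refine (lintegral_mono fun y => hpt y).trans ?_
    refine (lintegral_holder_I2 hδ0 hδ1 hFm hGm).trans ?_
    rw [hq']
    have hmono1 : ∫⁻ y in A, ‖ζ y • U y‖ₑ ^ (6 : ℝ) ≤ ∫⁻ y, ‖ζ y • U y‖ₑ ^ (6 : ℝ) :=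
      lintegral_mono' Measure.restrict_le_self le_rfl
    have hmono2 : ∫⁻ x in A, ‖U x‖ₑ ^ q ≤ ∫⁻ x in KR, ‖U x‖ₑ ^ q := lintegral_mono_set hAKR
    gcongr
  have hfin : (∫⁻ y, ‖ζ y • U y‖ₑ ^ (6 : ℝ)) ^ (δ / 6) * (∫⁻ x in KR, ‖U x‖ₑ ^ q) ^ ((6 - δ) / 6) ≠ ⊤ :=
    ENNReal.mul_ne_top (ENNReal.rpow_ne_top_of_nonneg (by positivity) hW6top)
      (ENNReal.rpow_ne_top_of_nonneg (by positivity) hEtop.ne)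
  have := ENNReal.toReal_mono hfin hH
  rw [ENNReal.toReal_mul, ← ENNReal.toReal_rpow, ← ENNReal.toReal_rpow] at this
  rw [setIntegral_eq_toReal_lintegral (f := fun y => ζ y * ‖U y‖ ^ 3) (hζ.mul (hU.norm.pow 3)) fun y =>
      mul_nonneg (h01 y).1 (pow_nonneg (norm_nonneg _) _),
    ← Real.rpow_mul ENNReal.toReal_nonneg, ← Real.rpow_mul ENNReal.toReal_nonneg,
    show 1 / 6 * δ = δ / 6 by ring, show 1 / q * (3 - δ) = (3 - δ) / q by rw [one_div, inv_mul_eq_div], h3q]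
  exact this

/-- **`∫_A ζ|P−c||U| ≤ ‖ζU‖₆^δ ‖P−c‖_{L^s(A)} ‖U‖^{1−δ}_{L^q(KR)}`** in real form (`s = 3(3−δ)/(6−δ)`,
`q = 2s`; Hölder twice, `lintegral_holder_I3a/b`). [cite: Tsai2021, proof of Thm 1.1 (Hölder for I₃)] -/
theorem I3_bound (hδ0 : 0 ≤ δ) (hδ1 : δ ≤ 1) (hU : Continuous U) (hP : Continuous P) (hζ : Continuous ζ)
    (hζc : HasCompactSupport ζ) (h01 : ∀ x, 0 ≤ ζ x ∧ ζ x ≤ 1) (hAKR : A ⊆ KR)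
    (hKR : KR ⊆ closedBall (0 : (EuclideanSpace ℝ (Fin 3))) ρ) (c : ℝ) :
    ∫ x in A, ζ x * (|P x - c| * ‖U x‖) ≤
      ((∫⁻ y, ‖ζ y • U y‖ₑ ^ (6 : ℝ)).toReal ^ (1 / 6 : ℝ)) ^ δ *
        ((∫⁻ y in A, ‖P y - c‖ₑ ^ (3 * (3 - δ) / (6 - δ))).toReal ^ (1 / (3 * (3 - δ) / (6 - δ)))) *
        ((∫⁻ x in KR, ‖U x‖ₑ ^ (6 * (3 - δ) / (6 - δ))).toReal ^ (1 / (6 * (3 - δ) / (6 - δ)))) ^ (1 - δ) := by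
  have h6 : 0 < 6 - δ := by linarith
  have h3 : 0 < 3 - δ := by linarith
  have h1 : 0 ≤ 1 - δ := by linarith
  generalize hq' : 6 * (3 - δ) / (6 - δ) = q
  generalize hs' : 3 * (3 - δ) / (6 - δ) = s
  have hq0 : 0 < q := by rw [← hq']; positivity
  have hs0 : 0 < s := by rw [← hs']; positivity
  have e1 : 2 / (3 - δ) * ((6 - δ) / 6) = 1 / s := by rw [← hs']; field_simp; norm_num
  have e2 : (1 - δ) / (3 - δ) * ((6 - δ) / 6) = (1 - δ) / q := by rw [← hq']; field_simp
  have hEtop : ∫⁻ x in KR, ‖U x‖ₑ ^ q < ⊤ := setLIntegral_enorm_rpow_lt_top hU hq0.le hKR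
  have hPstop : ∫⁻ y in A, ‖P y - c‖ₑ ^ s < ⊤ :=
    setLIntegral_enorm_rpow_lt_top (hP.sub continuous_const) hs0.le (hAKR.trans hKR)
  have hmemLp : MemLp (fun y => ζ y • U y) 6 volume := (hζ.smul hU).memLp_of_hasCompactSupport hζc.smul_right
  have hW6eq : eLpNorm (fun y => ζ y • U y) 6 volume = (∫⁻ y, ‖ζ y • U y‖ₑ ^ (6 : ℝ)) ^ (1 / 6 : ℝ) := by
    rw [eLpNorm_eq_lintegral_rpow_enorm_toReal (by norm_num) ENNReal.ofNat_ne_top, ENNReal.toReal_ofNat]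
  have hW6top : (∫⁻ y, ‖ζ y • U y‖ₑ ^ (6 : ℝ)) ≠ ⊤ := by
    intro h
    have := hmemLp.eLpNorm_lt_top
    rw [hW6eq, h, ENNReal.top_rpow_of_pos (by norm_num)] at this
    exact lt_irrefl _ this
  have hFeq : ∀ y, ‖ζ y • U y‖ₑ = ENNReal.ofReal (ζ y) * ‖U y‖ₑ := fun y => by
    rw [enorm_smul, Real.enorm_eq_ofReal (h01 y).1]
  have hFm : AEMeasurable (fun y => ‖ζ y • U y‖ₑ) (volume.restrict A) :=
    (hζ.smul hU).measurable.enorm.aemeasurable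
  have hGm : AEMeasurable (fun y => ‖U y‖ₑ) (volume.restrict A) := hU.measurable.enorm.aemeasurable
  have hPm : AEMeasurable (fun y => ‖P y - c‖ₑ) (volume.restrict A) :=
    (hP.sub continuous_const).measurable.enorm.aemeasurable
  have hHm : AEMeasurable (fun y => ‖P y - c‖ₑ * ‖U y‖ₑ ^ (1 - δ)) (volume.restrict A) :=
    hPm.mul (hGm.pow_const _)
  have hpt : ∀ y, ENNReal.ofReal (ζ y * (|P y - c| * ‖U y‖)) ≤
      ‖ζ y • U y‖ₑ ^ δ * (‖P y - c‖ₑ * ‖U y‖ₑ ^ (1 - δ)) := by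
    intro y
    have hreal : ζ y * (|P y - c| * ‖U y‖) ≤ (ζ y * ‖U y‖) ^ δ * (|P y - c| * ‖U y‖ ^ (1 - δ)) := by
      have e : (ζ y * ‖U y‖) ^ δ * (|P y - c| * ‖U y‖ ^ (1 - δ)) = ζ y ^ δ * (|P y - c| * ‖U y‖) := by
        rw [Real.mul_rpow (h01 y).1 (norm_nonneg _)]
        have : ‖U y‖ ^ δ * ‖U y‖ ^ (1 - δ) = ‖U y‖ := by
          rw [← Real.rpow_add' (norm_nonneg _) (by norm_num : δ + (1 - δ) ≠ 0),
            show δ + (1 - δ) = 1 by ring, Real.rpow_one]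
        calc ζ y ^ δ * ‖U y‖ ^ δ * (|P y - c| * ‖U y‖ ^ (1 - δ))
            = ζ y ^ δ * |P y - c| * (‖U y‖ ^ δ * ‖U y‖ ^ (1 - δ)) := by ring
          _ = ζ y ^ δ * (|P y - c| * ‖U y‖) := by rw [this]; ring
      rw [e]
      exact mul_le_mul_of_nonneg_right (le_rpow_of_le_one (h01 y).1 (h01 y).2 hδ1) (by positivity)
    calc ENNReal.ofReal (ζ y * (|P y - c| * ‖U y‖))
        ≤ ENNReal.ofReal ((ζ y * ‖U y‖) ^ δ * (|P y - c| * ‖U y‖ ^ (1 - δ))) := ENNReal.ofReal_le_ofReal hreal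
      _ = ‖ζ y • U y‖ₑ ^ δ * (‖P y - c‖ₑ * ‖U y‖ₑ ^ (1 - δ)) := by
          rw [ENNReal.ofReal_mul (Real.rpow_nonneg (mul_nonneg (h01 y).1 (norm_nonneg _)) _),
            ← ENNReal.ofReal_rpow_of_nonneg (mul_nonneg (h01 y).1 (norm_nonneg _)) hδ0,
            ENNReal.ofReal_mul (abs_nonneg _), ← ENNReal.ofReal_rpow_of_nonneg (norm_nonneg _) h1,
            ENNReal.ofReal_mul (h01 y).1, ofReal_norm, hFeq, ← Real.enorm_eq_ofReal_abs]
  have hH : ∫⁻ y in A, ENNReal.ofReal (ζ y * (|P y - c| * ‖U y‖)) ≤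
      (∫⁻ y, ‖ζ y • U y‖ₑ ^ (6 : ℝ)) ^ (δ / 6) *
        ((∫⁻ y in A, ‖P y - c‖ₑ ^ s) ^ (2 / (3 - δ)) * (∫⁻ x in KR, ‖U x‖ₑ ^ q) ^ ((1 - δ) / (3 - δ)))
          ^ ((6 - δ) / 6) := by
    refine (lintegral_mono fun y => hpt y).trans ?_
    refine (lintegral_holder_I3a hδ0 hδ1 hFm hHm).trans ?_
    have hmono1 : ∫⁻ y in A, ‖ζ y • U y‖ₑ ^ (6 : ℝ) ≤ ∫⁻ y, ‖ζ y • U y‖ₑ ^ (6 : ℝ) :=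
      lintegral_mono' Measure.restrict_le_self le_rfl
    have hb := lintegral_holder_I3b (μ := volume.restrict A) hδ1 hPm hGm
    rw [hq', hs'] at hb
    have hmono2 : (∫⁻ y in A, ‖P y - c‖ₑ ^ s) ^ (2 / (3 - δ)) * (∫⁻ x in A, ‖U x‖ₑ ^ q) ^ ((1 - δ) / (3 - δ)) ≤
        (∫⁻ y in A, ‖P y - c‖ₑ ^ s) ^ (2 / (3 - δ)) * (∫⁻ x in KR, ‖U x‖ₑ ^ q) ^ ((1 - δ) / (3 - δ)) := by
      have : ∫⁻ x in A, ‖U x‖ₑ ^ q ≤ ∫⁻ x in KR, ‖U x‖ₑ ^ q := lintegral_mono_set hAKR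
      gcongr
    gcongr
    exact hb.trans hmono2
  have hfin : (∫⁻ y, ‖ζ y • U y‖ₑ ^ (6 : ℝ)) ^ (δ / 6) *
      ((∫⁻ y in A, ‖P y - c‖ₑ ^ s) ^ (2 / (3 - δ)) * (∫⁻ x in KR, ‖U x‖ₑ ^ q) ^ ((1 - δ) / (3 - δ)))
        ^ ((6 - δ) / 6) ≠ ⊤ :=
    ENNReal.mul_ne_top (ENNReal.rpow_ne_top_of_nonneg (by positivity) hW6top)
      (ENNReal.rpow_ne_top_of_nonneg (by positivity) (ENNReal.mul_ne_top
        (ENNReal.rpow_ne_top_of_nonneg (by positivity) hPstop.ne)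
        (ENNReal.rpow_ne_top_of_nonneg (div_nonneg h1 h3.le) hEtop.ne)))
  have := ENNReal.toReal_mono hfin hH
  rw [ENNReal.toReal_mul, ← ENNReal.toReal_rpow, ← ENNReal.toReal_rpow, ENNReal.toReal_mul,
    ← ENNReal.toReal_rpow, ← ENNReal.toReal_rpow,
    Real.mul_rpow (Real.rpow_nonneg ENNReal.toReal_nonneg _) (Real.rpow_nonneg ENNReal.toReal_nonneg _),
    ← Real.rpow_mul ENNReal.toReal_nonneg, ← Real.rpow_mul ENNReal.toReal_nonneg, e1, e2] at this
  rw [setIntegral_eq_toReal_lintegral (f := fun y => ζ y * (|P y - c| * ‖U y‖))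
      (hζ.mul ((hP.sub continuous_const).abs.mul hU.norm)) fun y => mul_nonneg (h01 y).1 (by positivity),
    ← Real.rpow_mul ENNReal.toReal_nonneg, ← Real.rpow_mul ENNReal.toReal_nonneg,
    show 1 / 6 * δ = δ / 6 by ring, show 1 / q * (1 - δ) = (1 - δ) / q by rw [one_div, inv_mul_eq_div],
    mul_assoc]
  exact this

/-- `∫ |U|²‖Dζ‖² ≤ (K/R)² ∫_A |U|²` when `‖Dζ‖ ≤ K/R` and `Dζ` vanishes off the compact set `A`. [folklore] -/
theorem Z_bound (hU : Continuous U) (hAc : IsCompact A) (hAm : MeasurableSet A)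
    {M : ℝ} (hD : ∀ x, ‖fderiv ℝ ζ x‖ ≤ M) (hoff : ∀ x, x ∉ A → fderiv ℝ ζ x = 0) :
    ∫ x, ‖U x‖ ^ 2 * ‖fderiv ℝ ζ x‖ ^ 2 ≤ M ^ 2 * ∫ x in A, ‖U x‖ ^ 2 := by
  have hpt : ∀ x, ‖‖U x‖ ^ 2 * ‖fderiv ℝ ζ x‖ ^ 2‖ ≤ A.indicator (fun y => M ^ 2 * ‖U y‖ ^ 2) x := by
    intro x
    rw [Real.norm_of_nonneg (by positivity)]
    by_cases hx : x ∈ A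
    · rw [indicator_of_mem hx, mul_comm]
      exact mul_le_mul_of_nonneg_right (pow_le_pow_left₀ (norm_nonneg _) (hD x) 2) (sq_nonneg _)
    · rw [indicator_of_notMem hx, hoff x hx, norm_zero]; simp
  have hint : Integrable (A.indicator fun y => M ^ 2 * ‖U y‖ ^ 2) :=
    ((continuous_const.mul (hU.norm.pow 2)).continuousOn.integrableOn_compact hAc).integrable_indicator hAm
  have := norm_integral_le_of_norm_le hint (Eventually.of_forall hpt)
  rw [integral_indicator hAm, integral_const_mul] at this
  exact (le_abs_self _).trans ((Real.norm_eq_abs _).symm.trans_le this)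

/-- **Sobolev plus the shell bound for `Dζ`**:
`‖ζU‖₆² ≤ C_S²(2∫ζ²|DU|² + 2M²∫_A|U|²)`. [cite: Tsai2021, proof of Thm 1.1 (Sobolev inequality for uζ)] -/
theorem six_sq_le_shell (hζ : ContDiff ℝ ∞ ζ) (hζc : HasCompactSupport ζ) (hU : ContDiff ℝ ∞ U)
    (hAc : IsCompact A) (hAm : MeasurableSet A) {M : ℝ} (hD : ∀ x, ‖fderiv ℝ ζ x‖ ≤ M)
    (hoff : ∀ x, x ∉ A → fderiv ℝ ζ x = 0) :
    (eLpNorm (fun x => ζ x • U x) 6 volume).toReal ^ 2 ≤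
      (SNormLESNormFDerivOfEqConst (EuclideanSpace ℝ (Fin 3)) (volume : Measure (EuclideanSpace ℝ (Fin 3))) 2 : ℝ) ^ 2 *
        (2 * (∫ x, ζ x ^ 2 * frobeniusNormSq (fderiv ℝ U x)) + 2 * (M ^ 2 * ∫ x in A, ‖U x‖ ^ 2)) := by
  have h1 := eLpNorm_six_sq_le hζ hζc hU
  have h2 := Z_bound (ζ := ζ) hU.continuous hAc hAm hD hoff
  refine h1.trans (mul_le_mul_of_nonneg_left ?_ (sq_nonneg _))
  linarith

/-- The pressure estimate of `pressure_osc_shell_scaled` in real form: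
`π ≤ Cp (R⁻¹ x V^{1/s−1/q} + x²)`, `x = ‖U‖_{L^q(KR)}`, `vol(KR) ≤ V`
(`‖U‖_{L^s(KR)} ≤ ‖U‖_{L^q(KR)} vol(KR)^{1/s−1/q}`). [cite: Tsai2021, (3.5) with Hölder] -/
theorem pressure_bound_real (hU : Continuous U) {s q : ℝ} (hs0 : 0 < s) (hsq : s ≤ q)
    (hKR : KR ⊆ closedBall (0 : (EuclideanSpace ℝ (Fin 3))) ρ) {V : ℝ≥0∞} (hV : volume KR ≤ V) (hVtop : V ≠ ⊤) {Cp : ℝ≥0}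
    {R : ℝ} (hR : 0 < R) {Pe : ℝ≥0∞}
    (hPc : Pe ≤ Cp * (ENNReal.ofReal R⁻¹ * eLpNorm U (ENNReal.ofReal s) (volume.restrict KR) +
      eLpNorm U (ENNReal.ofReal q) (volume.restrict KR) ^ (2 : ℝ))) :
    Pe.toReal ≤ Cp * (R⁻¹ * ((∫⁻ x in KR, ‖U x‖ₑ ^ q).toReal ^ (1 / q) * V.toReal ^ (1 / s - 1 / q)) +
      ((∫⁻ x in KR, ‖U x‖ₑ ^ q).toReal ^ (1 / q)) ^ (2 : ℝ)) := by
  have hq0 : 0 < q := hs0.trans_le hsq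
  have hsq' : 0 ≤ 1 / s - 1 / q := by
    rw [sub_nonneg]; exact one_div_le_one_div_of_le hs0 hsq
  have hps_le : ENNReal.ofReal s ≤ ENNReal.ofReal q := ENNReal.ofReal_le_ofReal hsq
  have hEtop : ∫⁻ x in KR, ‖U x‖ₑ ^ q < ⊤ := setLIntegral_enorm_rpow_lt_top hU hq0.le hKR
  have hXE : eLpNorm U (ENNReal.ofReal q) (volume.restrict KR) = (∫⁻ x in KR, ‖U x‖ₑ ^ q) ^ (1 / q) := by
    rw [eLpNorm_eq_lintegral_rpow_enorm_toReal (ENNReal.ofReal_pos.2 hq0).ne' ENNReal.ofReal_ne_top,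
      ENNReal.toReal_ofReal hq0.le]
  have hXtop : (∫⁻ x in KR, ‖U x‖ₑ ^ q) ^ (1 / q) ≠ ⊤ :=
    ENNReal.rpow_ne_top_of_nonneg (by positivity) hEtop.ne
  have hXs : eLpNorm U (ENNReal.ofReal s) (volume.restrict KR) ≤
      (∫⁻ x in KR, ‖U x‖ₑ ^ q) ^ (1 / q) * V ^ (1 / s - 1 / q) := by
    have h := eLpNorm_le_eLpNorm_mul_rpow_measure_univ hps_le
      (hU.aestronglyMeasurable : AEStronglyMeasurable U (volume.restrict KR))
    rw [hXE, Measure.restrict_apply_univ, ENNReal.toReal_ofReal hs0.le, ENNReal.toReal_ofReal hq0.le] at h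
    refine h.trans ?_
    gcongr
  have hbound : Pe ≤ Cp * (ENNReal.ofReal R⁻¹ * ((∫⁻ x in KR, ‖U x‖ₑ ^ q) ^ (1 / q) * V ^ (1 / s - 1 / q)) +
      ((∫⁻ x in KR, ‖U x‖ₑ ^ q) ^ (1 / q)) ^ (2 : ℝ)) := by
    refine hPc.trans ?_
    rw [hXE]
    gcongr
  have hfin : (Cp : ℝ≥0∞) * (ENNReal.ofReal R⁻¹ * ((∫⁻ x in KR, ‖U x‖ₑ ^ q) ^ (1 / q) * V ^ (1 / s - 1 / q)) +
      ((∫⁻ x in KR, ‖U x‖ₑ ^ q) ^ (1 / q)) ^ (2 : ℝ)) ≠ ⊤ := by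
    refine ENNReal.mul_ne_top ENNReal.coe_ne_top (ENNReal.add_ne_top.2 ⟨?_, ?_⟩)
    · exact ENNReal.mul_ne_top ENNReal.ofReal_ne_top (ENNReal.mul_ne_top hXtop
        (ENNReal.rpow_ne_top_of_nonneg hsq' hVtop))
    · exact ENNReal.rpow_ne_top_of_nonneg zero_le_two hXtop
  have := ENNReal.toReal_mono hfin hbound
  rw [ENNReal.toReal_mul, ENNReal.coe_toReal, ENNReal.toReal_add ?_ ?_, ENNReal.toReal_mul, ENNReal.toReal_mul,
    ENNReal.toReal_ofReal (inv_nonneg.2 hR.le), ← ENNReal.toReal_rpow, ← ENNReal.toReal_rpow,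
    ← ENNReal.toReal_rpow, ← ENNReal.toReal_rpow] at this
  · exact this
  · exact ENNReal.mul_ne_top ENNReal.ofReal_ne_top (ENNReal.mul_ne_top hXtop
      (ENNReal.rpow_ne_top_of_nonneg hsq' hVtop))
  · exact ENNReal.rpow_ne_top_of_nonneg zero_le_two hXtop

end RealBounds

/-! ### §14. The energy estimate (3.6)–(3.7) at radius `R` -/

section Energy

variable {ν δ : ℝ} {U : (EuclideanSpace ℝ (Fin 3)) → (EuclideanSpace ℝ (Fin 3))} {P : (EuclideanSpace ℝ (Fin 3)) → ℝ}

set_option maxHeartbeats 1600000 in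
/-- **Tsai's energy estimate (3.7) with the bookkeeping (3.8) at `α = 0`.** Fix `ν > 0`,
`0 ≤ δ ≤ 1`, `q = 6(3−δ)/(6−δ)`, `s = q/2`, a smooth steady profile `(U, P)`, radii
`1 < a < b < L`, a cut-off constant `K` and a pressure constant `Cp`. There is `C` such that for
every `R ≥ 1`, every cut-off `ζ` of the family `exists_cutoff_family` at `R` (plateau `|x| ≤ aR`,
support `|x| ≤ bR`) and every constant `c` with the pressure estimate
`‖P − c‖_{L^s(aR≤|x|≤bR)} ≤ Cp(R⁻¹‖U‖_{L^s(R<|x|<LR)} + ‖U‖²_{L^q(R<|x|<LR)})`, the localised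
Dirichlet energy obeys `∫ ζ²|DU|² ≤ C (Q^{2/(3−δ)} + (Q + Q^{(2−δ)/(3−δ)})^{2/(2−δ)})`,
`Q = R⁻¹ ‖U‖^{3−δ}_{L^q(R<|x|<LR)}` — the tree's form of (3.7) with (3.8) (`β(δ,0) = −1/(3−δ)`):
the energy identity tested with `ζ²`, Hölder, Sobolev for `ζU`, Young, and the negative powers
of `R` discarded for `R ≥ 1`. [cite: Tsai2021, Thm 1.1 (a): (3.6)–(3.8)] -/
theorem energy_estimate (hν : 0 < ν) (hδ0 : 0 ≤ δ) (hδ1 : δ ≤ 1) (hprof : IsLerayProfile ν 0 U P)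
    (hU : ContDiff ℝ ∞ U) {a b L : ℝ} (ha : 1 < a) (hab : a < b) (hbL : b < L) {K : ℝ}
    (hK : 0 ≤ K) (Cp : ℝ≥0) :
    ∃ C : ℝ, ∀ R : ℝ, 1 ≤ R → ∀ ζ : (EuclideanSpace ℝ (Fin 3)) → ℝ, ContDiff ℝ ∞ ζ → HasCompactSupport ζ →
      (∀ x, 0 ≤ ζ x ∧ ζ x ≤ 1) → (∀ x, b * R ≤ ‖x‖ → ζ x = 0) →
      (∀ x, ‖fderiv ℝ ζ x‖ ≤ K / R) → (∀ x, |(Δ (fun y => ζ y ^ 2)) x| ≤ K / R ^ 2) →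
      (∀ x, ¬ (a * R ≤ ‖x‖ ∧ ‖x‖ ≤ b * R) → fderiv ℝ ζ x = 0 ∧ (Δ (fun y => ζ y ^ 2)) x = 0) →
      ∀ c : ℝ, eLpNorm (fun x => P x - c) (ENNReal.ofReal (3 * (3 - δ) / (6 - δ)))
          (volume.restrict {x : (EuclideanSpace ℝ (Fin 3)) | a * R ≤ ‖x‖ ∧ ‖x‖ ≤ b * R}) ≤
        Cp * (ENNReal.ofReal R⁻¹ * eLpNorm U (ENNReal.ofReal (3 * (3 - δ) / (6 - δ)))
              (volume.restrict {x : (EuclideanSpace ℝ (Fin 3)) | 1 * R < ‖x‖ ∧ ‖x‖ < L * R}) +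
          eLpNorm U (2 * ENNReal.ofReal (3 * (3 - δ) / (6 - δ)))
              (volume.restrict {x : (EuclideanSpace ℝ (Fin 3)) | 1 * R < ‖x‖ ∧ ‖x‖ < L * R}) ^ (2 : ℝ)) →
      ∫ x, ζ x ^ 2 * frobeniusNormSq (fderiv ℝ U x) ≤
        C * ((R⁻¹ * ((∫⁻ x in {x : (EuclideanSpace ℝ (Fin 3)) | 1 * R < ‖x‖ ∧ ‖x‖ < L * R},
              ‖U x‖ₑ ^ (6 * (3 - δ) / (6 - δ))).toReal) ^ ((3 - δ) / (6 * (3 - δ) / (6 - δ))))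
              ^ (2 / (3 - δ)) +
          (R⁻¹ * ((∫⁻ x in {x : (EuclideanSpace ℝ (Fin 3)) | 1 * R < ‖x‖ ∧ ‖x‖ < L * R},
              ‖U x‖ₑ ^ (6 * (3 - δ) / (6 - δ))).toReal) ^ ((3 - δ) / (6 * (3 - δ) / (6 - δ))) +
           (R⁻¹ * ((∫⁻ x in {x : (EuclideanSpace ℝ (Fin 3)) | 1 * R < ‖x‖ ∧ ‖x‖ < L * R},
              ‖U x‖ₑ ^ (6 * (3 - δ) / (6 - δ))).toReal) ^ ((3 - δ) / (6 * (3 - δ) / (6 - δ))))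
              ^ ((2 - δ) / (3 - δ))) ^ (2 / (2 - δ))) := by
  -- exponents (generalized names with defining equations, to keep terms small)
  generalize hq' : 6 * (3 - δ) / (6 - δ) = q
  generalize hs' : 3 * (3 - δ) / (6 - δ) = s
  have hq : q = 6 * (3 - δ) / (6 - δ) := hq'.symm
  have hs : s = 3 * (3 - δ) / (6 - δ) := hs'.symm
  have h6 : 0 < 6 - δ := by linarith
  have h3 : 0 < 3 - δ := by linarith
  have hq2 : 2 ≤ q := by rw [hq, le_div_iff₀ h6]; nlinarith
  have hq0 : 0 < q := by linarith
  have hs1 : 1 < s := by rw [hs, lt_div_iff₀ h6]; nlinarith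
  have hs0 : 0 < s := by linarith
  have hqs : q = 2 * s := by rw [hq, hs]; ring
  have h3q : (3 - δ) / q = (6 - δ) / 6 := by rw [hq]; field_simp
  have hpqs : 2 * ENNReal.ofReal s = ENNReal.ofReal q := by
    rw [hqs, ENNReal.ofReal_mul zero_le_two, ENNReal.ofReal_ofNat]
  have hpq0 : ENNReal.ofReal q ≠ 0 := (ENNReal.ofReal_pos.2 hq0).ne'
  have hps0 : ENNReal.ofReal s ≠ 0 := (ENNReal.ofReal_pos.2 hs0).ne'
  have hsq_le : s ≤ q := by linarith
  have h1sq : 1 / s - 1 / q = 1 / q := by rw [hqs]; field_simp; norm_num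
  -- the Sobolev constant and the final constant
  obtain ⟨CS, hCS⟩ : ∃ CS : ℝ, CS = (SNormLESNormFDerivOfEqConst (EuclideanSpace ℝ (Fin 3)) (volume : Measure (EuclideanSpace ℝ (Fin 3))) 2 : ℝ) :=
    ⟨_, rfl⟩
  have hCS0 : 0 ≤ CS := by rw [hCS]; exact NNReal.coe_nonneg _
  have hL1 : 1 < L := ha.trans (hab.trans hbL)
  obtain ⟨cL, hcL⟩ : ∃ cL : ℝ, cL = (volume (ball (0 : (EuclideanSpace ℝ (Fin 3))) 1)).toReal * L ^ 3 + 1 := ⟨_, rfl⟩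
  have hcL1 : 1 ≤ cL := by
    rw [hcL]
    nlinarith [ENNReal.toReal_nonneg (a := volume (ball (0:(EuclideanSpace ℝ (Fin 3))) 1)), pow_pos (zero_lt_one.trans hL1) 3]
  have hcL0 : 0 < cL := by linarith
  obtain ⟨κ, hκ⟩ : ∃ κ : ℝ, κ = ν / (4 * CS ^ 2 + 4) := ⟨_, rfl⟩
  have hκ0 : 0 < κ := by rw [hκ]; positivity
  obtain ⟨K', hK'⟩ : ∃ K' : ℝ, K' = K * (1 + 2 * Cp) * (1 + cL) := ⟨_, rfl⟩
  have hK'0 : 0 ≤ K' := by rw [hK']; positivity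
  obtain ⟨C₁, hC₁⟩ : ∃ C₁ : ℝ, C₁ = (4 / (3 * ν) * (ν / 2 * K) + K ^ 2 / 3) * cL := ⟨_, rfl⟩
  have hC₁0 : 0 ≤ C₁ := by rw [hC₁]; positivity
  obtain ⟨C₂, hC₂⟩ : ∃ C₂ : ℝ, C₂ = 4 / (3 * ν) * (κ ^ (-(δ / (2 - δ))) * K' ^ (2 / (2 - δ))) := ⟨_, rfl⟩
  have hC₂0 : 0 ≤ C₂ := by
    rw [hC₂]; exact mul_nonneg (by positivity) (mul_nonneg (Real.rpow_nonneg hκ0.le _) (Real.rpow_nonneg hK'0 _))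
  refine ⟨C₁ + C₂, fun R hR ζ hζ hζc h01 hzero hD hΔ hoff c hPc => ?_⟩
  have hR0 : 0 < R := by linarith
  have hL0 : 0 < L := by linarith
  have hKR : 0 ≤ K / R := by positivity
  -- the sets
  set A : Set (EuclideanSpace ℝ (Fin 3)) := {x | a * R ≤ ‖x‖ ∧ ‖x‖ ≤ b * R} with hA
  set KR : Set (EuclideanSpace ℝ (Fin 3)) := {x | 1 * R < ‖x‖ ∧ ‖x‖ < L * R} with hKRdef
  have hAm : MeasurableSet A := measurableSet_shell_closed _ _
  have hAc : IsCompact A := isCompact_shell_closed _ _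
  have hAKR : A ⊆ KR := fun x hx => ⟨by nlinarith [hx.1], by nlinarith [hx.2]⟩
  have hKRball : KR ⊆ ball (0 : (EuclideanSpace ℝ (Fin 3))) (L * R) := fun x hx => mem_ball_zero_iff.2 hx.2
  have hKRcb : KR ⊆ closedBall (0 : (EuclideanSpace ℝ (Fin 3))) (L * R) := hKRball.trans ball_subset_closedBall
  have hAcb : A ⊆ closedBall (0 : (EuclideanSpace ℝ (Fin 3))) (L * R) := hAKR.trans hKRcb
  have hvolKR : volume KR ≤ ENNReal.ofReal (cL * R ^ 3) := by
    refine (measure_mono hKRball).trans ?_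
    rw [Measure.addHaar_ball_of_pos _ _ (by positivity), finrank_euclideanSpace_fin, hcL,
      ENNReal.ofReal_mul (by positivity)]
    have hv : volume (ball (0 : (EuclideanSpace ℝ (Fin 3))) 1) ≠ ⊤ := measure_ball_lt_top.ne
    calc ENNReal.ofReal ((L * R) ^ 3) * volume (ball (0 : (EuclideanSpace ℝ (Fin 3))) 1)
        = ENNReal.ofReal ((volume (ball (0 : (EuclideanSpace ℝ (Fin 3))) 1)).toReal * L ^ 3) * ENNReal.ofReal (R ^ 3) := by
          rw [ENNReal.ofReal_mul ENNReal.toReal_nonneg, ENNReal.ofReal_toReal hv, mul_pow,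
            ENNReal.ofReal_mul (by positivity)]
          ring
      _ ≤ ENNReal.ofReal ((volume (ball (0 : (EuclideanSpace ℝ (Fin 3))) 1)).toReal * L ^ 3 + 1) * ENNReal.ofReal (R ^ 3) := by
          gcongr; linarith
  have hvolA : volume A ≤ ENNReal.ofReal (cL * R ^ 3) := (measure_mono hAKR).trans hvolKR
  -- smoothness and the test function `φ = ζ²`
  have hUc : Continuous U := hU.continuous
  have hU1 : ContDiff ℝ 1 U := hU.of_le (by norm_cast)
  have hζ1 : ContDiff ℝ 1 ζ := hζ.of_le (by norm_cast)
  have hP : ContDiff ℝ ∞ P := contDiff_pressure_top hprof hU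
  have hφs : ContDiff ℝ ∞ fun y => ζ y ^ 2 := hζ.pow 2
  have hφc : HasCompactSupport fun y => ζ y ^ 2 := by
    have h : HasCompactSupport fun y => ζ y * ζ y := hζc.mul_right
    simpa only [sq] using h
  have hDφ : ∀ x v, fderiv ℝ (fun y => ζ y ^ 2) x v = 2 * ζ x * fderiv ℝ ζ x v :=
    fun x v => fderiv_sq_apply hζ1 x v
  -- `E`, `x`, `Q`
  generalize hE' : (∫⁻ x in KR, ‖U x‖ₑ ^ q) = E
  have hE : E = ∫⁻ x in KR, ‖U x‖ₑ ^ q := hE'.symm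
  have hEtop : E < ⊤ := by rw [hE]; exact setLIntegral_enorm_rpow_lt_top hUc hq0.le hKRcb
  have hEA_le : ∫⁻ x in A, ‖U x‖ₑ ^ q ≤ E := by rw [hE]; exact lintegral_mono_set hAKR
  obtain ⟨x, hx⟩ : ∃ x : ℝ, x = E.toReal ^ (1 / q) := ⟨_, rfl⟩
  have hx0 : 0 ≤ x := by rw [hx]; exact Real.rpow_nonneg ENNReal.toReal_nonneg _
  have hxpow : ∀ t : ℝ, x ^ t = E.toReal ^ (t / q) := fun t => by
    rw [hx, ← Real.rpow_mul ENNReal.toReal_nonneg, show 1 / q * t = t / q by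
      rw [one_div, inv_mul_eq_div]]
  generalize hQ' : R⁻¹ * E.toReal ^ ((3 - δ) / q) = Q
  have hQx : Q = R⁻¹ * x ^ (3 - δ) := by rw [← hQ', hxpow (3 - δ)]
  have hQ0 : 0 ≤ Q := by rw [hQx]; positivity
  -- `Y`
  generalize hY' : (∫ x, ζ x ^ 2 * frobeniusNormSq (fderiv ℝ U x)) = Y
  have hY0 : 0 ≤ Y := by
    rw [← hY']; exact integral_nonneg fun y => mul_nonneg (sq_nonneg _) (frobeniusNormSq_nonneg _)
  ----------------------------------------------------------------
  -- (1) the energy identity tested with `φ = ζ²`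
  ----------------------------------------------------------------
  have hEI := hprof.integral_mul_frobeniusNormSq_fderiv_eq hU (hφs.of_le (by norm_cast)) hφc c
  simp only [zero_div, zero_mul, add_zero] at hEI
  obtain ⟨J₁, hJ₁⟩ : ∃ J : ℝ, J = ∫ x, (Δ (fun y => ζ y ^ 2)) x * ‖U x‖ ^ 2 := ⟨_, rfl⟩
  obtain ⟨J₂, hJ₂⟩ : ∃ J : ℝ, J = ∫ x, fderiv ℝ (fun y => ζ y ^ 2) x (U x) * ‖U x‖ ^ 2 := ⟨_, rfl⟩
  obtain ⟨J₃, hJ₃⟩ : ∃ J : ℝ, J = ∫ x, (P x - c) * ⟪U x, gradient (fun y => ζ y ^ 2) x⟫ := ⟨_, rfl⟩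
  rw [hY', ← hJ₁, ← hJ₂, ← hJ₃] at hEI
  -- hEI : ν * Y = ν / 2 * J₁ + 1 / 2 * J₂ + J₃
  ----------------------------------------------------------------
  -- (2) pointwise bounds of the three integrands by indicators of `A`
  ----------------------------------------------------------------
  have hind : ∀ x, ¬ (a * R ≤ ‖x‖ ∧ ‖x‖ ≤ b * R) ↔ x ∉ A := fun x => Iff.rfl
  have hp1 : ∀ x, ‖(Δ (fun y => ζ y ^ 2)) x * ‖U x‖ ^ 2‖ ≤ A.indicator (fun y => K / R ^ 2 * ‖U y‖ ^ 2) x := by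
    intro x
    by_cases hx : x ∈ A
    · rw [indicator_of_mem hx, norm_mul, Real.norm_eq_abs, Real.norm_of_nonneg (sq_nonneg _)]
      exact mul_le_mul_of_nonneg_right (hΔ x) (sq_nonneg _)
    · rw [indicator_of_notMem hx, (hoff x ((hind x).2 hx)).2, zero_mul, norm_zero]
  have hp2 : ∀ x, ‖fderiv ℝ (fun y => ζ y ^ 2) x (U x) * ‖U x‖ ^ 2‖ ≤
      A.indicator (fun y => 2 * (K / R) * (ζ y * ‖U y‖ ^ 3)) x := by
    intro x
    by_cases hx : x ∈ A
    · rw [indicator_of_mem hx, hDφ, norm_mul, norm_mul, norm_mul, Real.norm_eq_abs, Real.norm_eq_abs,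
        Real.norm_eq_abs, abs_of_nonneg (h01 x).1, abs_two, Real.norm_of_nonneg (sq_nonneg _)]
      have hb : |fderiv ℝ ζ x (U x)| ≤ K / R * ‖U x‖ := by
        rw [← Real.norm_eq_abs]
        exact (ContinuousLinearMap.le_opNorm _ _).trans (mul_le_mul_of_nonneg_right (hD x) (norm_nonneg _))
      calc 2 * ζ x * |fderiv ℝ ζ x (U x)| * ‖U x‖ ^ 2
          = 2 * ζ x * (|fderiv ℝ ζ x (U x)| * ‖U x‖ ^ 2) := by ring
        _ ≤ 2 * ζ x * (K / R * ‖U x‖ * ‖U x‖ ^ 2) := by gcongr; exact mul_nonneg zero_le_two (h01 x).1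
        _ = 2 * (K / R) * (ζ x * ‖U x‖ ^ 3) := by ring
    · rw [indicator_of_notMem hx, hDφ, (hoff x ((hind x).2 hx)).1]
      simp
  have hp3 : ∀ x, ‖(P x - c) * ⟪U x, gradient (fun y => ζ y ^ 2) x⟫‖ ≤
      A.indicator (fun y => 2 * (K / R) * (ζ y * (|P y - c| * ‖U y‖))) x := by
    intro x
    have hgrad : ⟪U x, gradient (fun y => ζ y ^ 2) x⟫ = fderiv ℝ (fun y => ζ y ^ 2) x (U x) := by
      rw [gradient, real_inner_comm, InnerProductSpace.toDual_symm_apply]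
    rw [hgrad]
    by_cases hx : x ∈ A
    · rw [indicator_of_mem hx, hDφ, norm_mul, norm_mul, norm_mul, Real.norm_eq_abs, Real.norm_eq_abs,
        Real.norm_eq_abs, Real.norm_eq_abs, abs_of_nonneg (h01 x).1, abs_two]
      have hb : |fderiv ℝ ζ x (U x)| ≤ K / R * ‖U x‖ := by
        rw [← Real.norm_eq_abs]
        exact (ContinuousLinearMap.le_opNorm _ _).trans (mul_le_mul_of_nonneg_right (hD x) (norm_nonneg _))
      calc |P x - c| * (2 * ζ x * |fderiv ℝ ζ x (U x)|)
          = 2 * ζ x * |P x - c| * |fderiv ℝ ζ x (U x)| := by ring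
        _ ≤ 2 * ζ x * |P x - c| * (K / R * ‖U x‖) := by
            gcongr; exact mul_nonneg (mul_nonneg zero_le_two (h01 x).1) (abs_nonneg _)
        _ = 2 * (K / R) * (ζ x * (|P x - c| * ‖U x‖)) := by ring
    · rw [indicator_of_notMem hx, hDφ, (hoff x ((hind x).2 hx)).1]
      simp
  ----------------------------------------------------------------
  -- (3) the real integrals over `A`
  ----------------------------------------------------------------
  obtain ⟨IA, hIA⟩ : ∃ I : ℝ, I = ∫ x in A, ‖U x‖ ^ 2 := ⟨_, rfl⟩
  obtain ⟨I2, hI2⟩ : ∃ I : ℝ, I = ∫ x in A, ζ x * ‖U x‖ ^ 3 := ⟨_, rfl⟩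
  obtain ⟨I3, hI3⟩ : ∃ I : ℝ, I = ∫ x in A, ζ x * (|P x - c| * ‖U x‖) := ⟨_, rfl⟩
  have hc1 : Continuous fun y => ‖U y‖ ^ 2 := hUc.norm.pow 2
  have hc2 : Continuous fun y => ζ y * ‖U y‖ ^ 3 := hζ.continuous.mul (hUc.norm.pow 3)
  have hc3 : Continuous fun y => ζ y * (|P y - c| * ‖U y‖) :=
    hζ.continuous.mul ((hP.continuous.sub continuous_const).abs.mul hUc.norm)
  have hJ₁b : |J₁| ≤ K / R ^ 2 * IA := by
    have hint : Integrable (A.indicator fun y => K / R ^ 2 * ‖U y‖ ^ 2) :=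
      ((continuous_const.mul hc1).continuousOn.integrableOn_compact hAc).integrable_indicator hAm
    have := norm_integral_le_of_norm_le hint (Eventually.of_forall hp1)
    rw [Real.norm_eq_abs, integral_indicator hAm, integral_const_mul, ← hIA, ← hJ₁] at this
    exact this
  have hJ₂b : |J₂| ≤ 2 * (K / R) * I2 := by
    have hint : Integrable (A.indicator fun y => 2 * (K / R) * (ζ y * ‖U y‖ ^ 3)) :=
      ((continuous_const.mul hc2).continuousOn.integrableOn_compact hAc).integrable_indicator hAm
    have := norm_integral_le_of_norm_le hint (Eventually.of_forall hp2)
    rw [Real.norm_eq_abs, integral_indicator hAm, integral_const_mul, ← hI2, ← hJ₂] at this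
    exact this
  have hJ₃b : |J₃| ≤ 2 * (K / R) * I3 := by
    have hint : Integrable (A.indicator fun y => 2 * (K / R) * (ζ y * (|P y - c| * ‖U y‖))) :=
      ((continuous_const.mul hc3).continuousOn.integrableOn_compact hAc).integrable_indicator hAm
    have := norm_integral_le_of_norm_le hint (Eventually.of_forall hp3)
    rw [Real.norm_eq_abs, integral_indicator hAm, integral_const_mul, ← hI3, ← hJ₃] at this
    exact this
  have hIA0 : 0 ≤ IA := by rw [hIA]; exact setIntegral_nonneg hAm fun x _ => sq_nonneg _
  ----------------------------------------------------------------
  -- (4) the real-form bounds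
  ----------------------------------------------------------------
  generalize hW6' : (∫⁻ y, ‖ζ y • U y‖ₑ ^ (6 : ℝ)) = W6
  obtain ⟨w, hw⟩ : ∃ w : ℝ, w = W6.toReal ^ (1 / 6 : ℝ) := ⟨_, rfl⟩
  have hw0 : 0 ≤ w := by rw [hw]; exact Real.rpow_nonneg ENNReal.toReal_nonneg _
  have hweq : (eLpNorm (fun y => ζ y • U y) 6 volume).toReal = w := by
    rw [eLpNorm_eq_lintegral_rpow_enorm_toReal (by norm_num) ENNReal.ofNat_ne_top, ENNReal.toReal_ofNat,
      hW6', hw, ← ENNReal.toReal_rpow]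
  generalize hPs' : (∫⁻ y in A, ‖P y - c‖ₑ ^ s) = Ps
  obtain ⟨π, hπ⟩ : ∃ π : ℝ, π = Ps.toReal ^ (1 / s) := ⟨_, rfl⟩
  have hπ0 : 0 ≤ π := by rw [hπ]; exact Real.rpow_nonneg ENNReal.toReal_nonneg _
  have hπeq : (eLpNorm (fun y => P y - c) (ENNReal.ofReal s) (volume.restrict A)).toReal = π := by
    rw [eLpNorm_eq_lintegral_rpow_enorm_toReal hps0 ENNReal.ofReal_ne_top, ENNReal.toReal_ofReal hs0.le,
      hPs', hπ, ← ENNReal.toReal_rpow]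
  have hIAb : IA ≤ (cL * R ^ 3) ^ (1 - 2 / q) * x ^ (2 : ℝ) := by
    have h := IA_bound (A := A) hUc hq2 hAKR hKRcb hvolA ENNReal.ofReal_ne_top
    rw [hE', ENNReal.toReal_ofReal (by positivity), ← hx, ← hIA] at h
    exact h
  have hI2b : I2 ≤ w ^ δ * x ^ (3 - δ) := by
    have h := I2_bound (A := A) hδ0 hδ1 hUc hζ.continuous hζc h01 hAKR hKRcb
    rw [hq', hE', hW6', ← hx, ← hw, ← hI2] at h
    exact h
  have hI3b : I3 ≤ w ^ δ * π * x ^ (1 - δ) := by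
    have h := I3_bound (A := A) hδ0 hδ1 hUc hP.continuous hζ.continuous hζc h01 hAKR hKRcb c
    rw [hq', hs', hE', hW6', hPs', ← hx, ← hw, ← hπ, ← hI3] at h
    exact h
  have hw2 : w ^ (2 : ℕ) ≤ CS ^ 2 * (2 * Y + 2 * ((K / R) ^ 2 * IA)) := by
    have h := six_sq_le_shell (U := U) hζ hζc hU hAc hAm hD (fun y hy => (hoff y ((hind y).2 hy)).1)
    rw [hweq, hY', ← hCS, ← hIA] at h
    exact h
  have hπb : π ≤ Cp * (R⁻¹ * (x * (cL * R ^ 3) ^ (1 / q)) + x ^ (2 : ℝ)) := by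
    have hPc' := hPc
    rw [hpqs] at hPc'
    have h := pressure_bound_real (U := U) hUc hs0 hsq_le hKRcb hvolKR ENNReal.ofReal_ne_top hR0 hPc'
    rw [hπeq, hE', ← hx, ENNReal.toReal_ofReal (by positivity), h1sq] at h
    exact h
  ----------------------------------------------------------------
  -- (5) Young absorption
  ----------------------------------------------------------------
  obtain ⟨i, hi⟩ : ∃ i : ℝ, i = ν / 2 * (K / R ^ 2) * IA := ⟨_, rfl⟩
  obtain ⟨z, hz⟩ : ∃ z : ℝ, z = (K / R) ^ 2 * IA := ⟨_, rfl⟩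
  obtain ⟨m, hm⟩ : ∃ m : ℝ, m = K / R * (x ^ (3 - δ) + 2 * (π * x ^ (1 - δ))) := ⟨_, rfl⟩
  have hi0 : 0 ≤ i := by
    rw [hi]; exact mul_nonneg (mul_nonneg (by positivity) (div_nonneg hK (sq_nonneg _))) hIA0
  have hz0 : 0 ≤ z := by rw [hz]; exact mul_nonneg (sq_nonneg _) hIA0
  have hm0 : 0 ≤ m := by
    rw [hm]; exact mul_nonneg hKR (add_nonneg (Real.rpow_nonneg hx0 _)
      (mul_nonneg zero_le_two (mul_nonneg hπ0 (Real.rpow_nonneg hx0 _))))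
  have h1 : ν * Y ≤ i + w ^ δ * m := by
    have e1 : ν / 2 * J₁ ≤ i := by
      have h := mul_le_mul_of_nonneg_left ((le_abs_self J₁).trans hJ₁b) (by positivity : (0 : ℝ) ≤ ν / 2)
      rw [hi, mul_assoc]; exact h
    have e2 : 1 / 2 * J₂ ≤ K / R * (w ^ δ * x ^ (3 - δ)) := by
      have h := (le_abs_self J₂).trans hJ₂b
      have h' := mul_le_mul_of_nonneg_left hI2b hKR
      linarith only [h, h']
    have e3 : J₃ ≤ 2 * (K / R) * (w ^ δ * π * x ^ (1 - δ)) :=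
      ((le_abs_self _).trans hJ₃b).trans (mul_le_mul_of_nonneg_left hI3b (by positivity))
    have e4 : w ^ δ * m = K / R * (w ^ δ * x ^ (3 - δ)) + 2 * (K / R) * (w ^ δ * π * x ^ (1 - δ)) := by
      rw [hm]; ring
    rw [hEI, e4]
    linarith only [e1, e2, e3]
  have h2 : w ^ (2 : ℕ) ≤ CS ^ 2 * (2 * Y + 2 * z) := by rw [hz]; exact hw2
  have habs := absorb hν hδ0 hδ1 hY0 hz0 hw0 hm0 (sq_nonneg CS) h1 h2
  rw [← hκ] at habs
  ----------------------------------------------------------------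
  -- (6) bookkeeping in `Q`
  ----------------------------------------------------------------
  have h2q : 0 ≤ 1 - 2 / q := by rw [sub_nonneg, div_le_one hq0]; exact hq2
  have h2q1 : 1 - 2 / q ≤ 1 := by linarith [div_nonneg zero_le_two hq0.le]
  have h1q1 : 1 / q ≤ 1 := by rw [div_le_one hq0]; linarith
  have hcLa : cL ^ (1 - 2 / q) ≤ cL := by
    conv_rhs => rw [← Real.rpow_one cL]
    exact Real.rpow_le_rpow_of_exponent_le hcL1 h2q1
  have hcLb : cL ^ (1 / q) ≤ cL := by
    conv_rhs => rw [← Real.rpow_one cL]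
    exact Real.rpow_le_rpow_of_exponent_le hcL1 h1q1
  -- `R⁻²(cL R³)^{1−2/q} x² ≤ cL Q^{2/(3−δ)}`
  have hbookA : R⁻¹ ^ 2 * ((cL * R ^ 3) ^ (1 - 2 / q) * x ^ (2 : ℝ)) ≤ cL * Q ^ (2 / (3 - δ)) := by
    have hsplit : (cL * R ^ 3) ^ (1 - 2 / q) = cL ^ (1 - 2 / q) * R ^ (3 * (1 - 2 / q)) := by
      rw [Real.mul_rpow hcL0.le (by positivity), show (R ^ 3 : ℝ) = R ^ (3 : ℝ) by norm_cast,
        ← Real.rpow_mul hR0.le]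
    have hR2 : R⁻¹ ^ 2 * R ^ (3 * (1 - 2 / q)) = R ^ (1 - 6 / q) := by
      rw [inv_pow, ← Real.rpow_natCast R 2, ← Real.rpow_neg hR0.le, ← Real.rpow_add hR0]
      congr 1; push_cast; field_simp; ring
    have hba := bookkeeping_a (X := x) hδ1 hR hx0
    rw [hq', ← hQx] at hba
    calc R⁻¹ ^ 2 * ((cL * R ^ 3) ^ (1 - 2 / q) * x ^ (2 : ℝ))
        = cL ^ (1 - 2 / q) * ((R⁻¹ ^ 2 * R ^ (3 * (1 - 2 / q))) * x ^ (2 : ℝ)) := by rw [hsplit]; ring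
      _ = cL ^ (1 - 2 / q) * (R ^ (1 - 6 / q) * x ^ (2 : ℝ)) := by rw [hR2]
      _ ≤ cL * Q ^ (2 / (3 - δ)) :=
          mul_le_mul hcLa hba (mul_nonneg (Real.rpow_nonneg hR0.le _) (Real.rpow_nonneg hx0 _)) hcL0.le
  have hi_b : i ≤ ν / 2 * K * (cL * Q ^ (2 / (3 - δ))) := by
    rw [hi]
    calc ν / 2 * (K / R ^ 2) * IA = ν / 2 * K * (R⁻¹ ^ 2 * IA) := by rw [inv_pow]; ring
      _ ≤ ν / 2 * K * (R⁻¹ ^ 2 * ((cL * R ^ 3) ^ (1 - 2 / q) * x ^ (2 : ℝ))) := by gcongr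
      _ ≤ ν / 2 * K * (cL * Q ^ (2 / (3 - δ))) := by gcongr
  have hz_b : z ≤ K ^ 2 * (cL * Q ^ (2 / (3 - δ))) := by
    rw [hz]
    calc (K / R) ^ 2 * IA = K ^ 2 * (R⁻¹ ^ 2 * IA) := by rw [div_eq_mul_inv, mul_pow]; ring
      _ ≤ K ^ 2 * (R⁻¹ ^ 2 * ((cL * R ^ 3) ^ (1 - 2 / q) * x ^ (2 : ℝ))) := by gcongr
      _ ≤ K ^ 2 * (cL * Q ^ (2 / (3 - δ))) := by gcongr
  -- `m ≤ K'(Q + Q^{(2−δ)/(3−δ)})`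
  have hm_b : m ≤ K' * (Q + Q ^ ((2 - δ) / (3 - δ))) := by
    have hx1 : x * x ^ (1 - δ) = x ^ (2 - δ) := by
      rw [show (2 : ℝ) - δ = 1 + (1 - δ) by ring, Real.rpow_add' hx0 (by linarith : (1 : ℝ) + (1 - δ) ≠ 0),
        Real.rpow_one]
    have hx2 : x ^ (2 : ℝ) * x ^ (1 - δ) = x ^ (3 - δ) := by
      rw [show (3 : ℝ) - δ = 2 + (1 - δ) by ring, Real.rpow_add' hx0 (by linarith : (2 : ℝ) + (1 - δ) ≠ 0)]
    have hsplit : (cL * R ^ 3) ^ (1 / q) = cL ^ (1 / q) * R ^ (3 / q) := by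
      rw [Real.mul_rpow hcL0.le (by positivity), show (R ^ 3 : ℝ) = R ^ (3 : ℝ) by norm_cast,
        ← Real.rpow_mul hR0.le]
      congr 2; ring
    have hR2 : R⁻¹ * R⁻¹ * R ^ (3 / q) = R ^ (3 / q - 2) := by
      rw [← Real.rpow_neg_one R, ← Real.rpow_add hR0, ← Real.rpow_add hR0]
      congr 1; ring
    have hbb := bookkeeping_b (X := x) hδ1 hR hx0
    rw [hq', ← hQx] at hbb
    -- `R⁻¹ π x^{1−δ} ≤ Cp (cL Q^{(2−δ)/(3−δ)} + Q)`
    have hπx : R⁻¹ * (π * x ^ (1 - δ)) ≤ Cp * (cL * Q ^ ((2 - δ) / (3 - δ)) + Q) := by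
      have hx1δ : 0 ≤ x ^ (1 - δ) := Real.rpow_nonneg hx0 _
      calc R⁻¹ * (π * x ^ (1 - δ))
          ≤ R⁻¹ * ((Cp * (R⁻¹ * (x * (cL * R ^ 3) ^ (1 / q)) + x ^ (2 : ℝ))) * x ^ (1 - δ)) := by gcongr
        _ = Cp * (cL ^ (1 / q) * ((R⁻¹ * R⁻¹ * R ^ (3 / q)) * (x * x ^ (1 - δ))) +
              R⁻¹ * (x ^ (2 : ℝ) * x ^ (1 - δ))) := by rw [hsplit]; ring
        _ = Cp * (cL ^ (1 / q) * (R ^ (3 / q - 2) * x ^ (2 - δ)) + Q) := by rw [hR2, hx1, hx2, hQx]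
        _ ≤ Cp * (cL * Q ^ ((2 - δ) / (3 - δ)) + Q) := by
            have hcc : cL ^ (1 / q) * (R ^ (3 / q - 2) * x ^ (2 - δ)) ≤ cL * Q ^ ((2 - δ) / (3 - δ)) :=
              mul_le_mul hcLb hbb (mul_nonneg (Real.rpow_nonneg hR0.le _) (Real.rpow_nonneg hx0 _)) hcL0.le
            have hCp0 : (0 : ℝ) ≤ Cp := Cp.coe_nonneg
            exact mul_le_mul_of_nonneg_left (by linarith only [hcc]) hCp0
    have hQβ : 0 ≤ Q ^ ((2 - δ) / (3 - δ)) := Real.rpow_nonneg hQ0 _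
    rw [hm, hK']
    have hCp0 : (0 : ℝ) ≤ Cp := Cp.coe_nonneg
    have step1 : K / R * (x ^ (3 - δ) + 2 * (π * x ^ (1 - δ))) =
        K * (R⁻¹ * x ^ (3 - δ)) + 2 * K * (R⁻¹ * (π * x ^ (1 - δ))) := by rw [div_eq_mul_inv]; ring
    have step2 : K * (R⁻¹ * x ^ (3 - δ)) + 2 * K * (R⁻¹ * (π * x ^ (1 - δ))) ≤
        K * Q + 2 * K * (Cp * (cL * Q ^ ((2 - δ) / (3 - δ)) + Q)) := by
      rw [← hQx]
      have := mul_le_mul_of_nonneg_left hπx (by positivity : (0 : ℝ) ≤ 2 * K)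
      linarith only [this]
    have step3 : K * (1 + 2 * Cp) * (1 + cL) * (Q + Q ^ ((2 - δ) / (3 - δ))) -
        (K * Q + 2 * K * (Cp * (cL * Q ^ ((2 - δ) / (3 - δ)) + Q))) =
        K * Q * (cL + 2 * Cp * cL) + K * Q ^ ((2 - δ) / (3 - δ)) * (1 + 2 * Cp + cL) := by ring
    have step4 : 0 ≤ K * Q * (cL + 2 * Cp * cL) + K * Q ^ ((2 - δ) / (3 - δ)) * (1 + 2 * Cp + cL) :=
      add_nonneg (mul_nonneg (mul_nonneg hK hQ0) (by positivity))
        (mul_nonneg (mul_nonneg hK hQβ) (by positivity))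
    rw [step1]
    linarith only [step2, step3, step4]
  -- the power `m^{2/(2−δ)}`
  have h2δ : 0 ≤ 2 / (2 - δ) := div_nonneg zero_le_two (by linarith)
  have hmγ : m ^ (2 / (2 - δ)) ≤ K' ^ (2 / (2 - δ)) * (Q + Q ^ ((2 - δ) / (3 - δ))) ^ (2 / (2 - δ)) := by
    rw [← Real.mul_rpow hK'0 (add_nonneg hQ0 (Real.rpow_nonneg hQ0 _))]
    exact Real.rpow_le_rpow hm0 hm_b h2δ
  ----------------------------------------------------------------
  -- (7) collecting
  ----------------------------------------------------------------
  have hQα : 0 ≤ Q ^ (2 / (3 - δ)) := Real.rpow_nonneg hQ0 _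
  have hS : 0 ≤ (Q + Q ^ ((2 - δ) / (3 - δ))) ^ (2 / (2 - δ)) :=
    Real.rpow_nonneg (add_nonneg hQ0 (Real.rpow_nonneg hQ0 _)) _
  have hκδ : 0 ≤ κ ^ (-(δ / (2 - δ))) := Real.rpow_nonneg hκ0.le _
  have hmain : Y ≤ C₁ * Q ^ (2 / (3 - δ)) + C₂ * (Q + Q ^ ((2 - δ) / (3 - δ))) ^ (2 / (2 - δ)) := by
    have t1 : 4 / (3 * ν) * i ≤ 4 / (3 * ν) * (ν / 2 * K * (cL * Q ^ (2 / (3 - δ)))) := by gcongr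
    have t2 : z / 3 ≤ K ^ 2 * (cL * Q ^ (2 / (3 - δ))) / 3 := by gcongr
    have t3 : 4 / (3 * ν) * (κ ^ (-(δ / (2 - δ))) * m ^ (2 / (2 - δ))) ≤
        4 / (3 * ν) * (κ ^ (-(δ / (2 - δ))) * (K' ^ (2 / (2 - δ)) *
          (Q + Q ^ ((2 - δ) / (3 - δ))) ^ (2 / (2 - δ)))) := by gcongr
    have i1 : 4 / (3 * ν) * (ν / 2 * K * (cL * Q ^ (2 / (3 - δ)))) + K ^ 2 * (cL * Q ^ (2 / (3 - δ))) / 3 =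
        C₁ * Q ^ (2 / (3 - δ)) := by rw [hC₁]; ring
    have i2 : 4 / (3 * ν) * (κ ^ (-(δ / (2 - δ))) * (K' ^ (2 / (2 - δ)) *
        (Q + Q ^ ((2 - δ) / (3 - δ))) ^ (2 / (2 - δ)))) = C₂ * (Q + Q ^ ((2 - δ) / (3 - δ))) ^ (2 / (2 - δ)) := by
      rw [hC₂]; ring
    linarith only [t1, t2, t3, habs, i1, i2]
  have f1 := mul_nonneg hC₁0 hS
  have f2 := mul_nonneg hC₂0 hQα
  linarith only [hmain, f1, f2]

end Energy

/-! ### §15. Tsai's quantity: real form, and its growth for nonzero constants -/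

section Quantity

variable {δ L : ℝ} {U : (EuclideanSpace ℝ (Fin 3)) → (EuclideanSpace ℝ (Fin 3))}

/-- For `R > 0` and continuous `U`, Tsai's quantity is finite and its real value is
`Q = R⁻¹ ‖U‖^{3−δ}_{L^q(R<|x|<LR)}` (`(3−δ)/q = (6−δ)/6`). [cite: Tsai2021, Thm 1.1 (a), (1.6)] -/
theorem tsaiAnnulusQuantity_toReal (hδ1 : δ ≤ 1) (hU : Continuous U) {R : ℝ} (hR : 0 < R) :
    tsaiAnnulusQuantity δ L U R ≠ ⊤ ∧
      (tsaiAnnulusQuantity δ L U R).toReal =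
        R⁻¹ * ((∫⁻ x in {x : (EuclideanSpace ℝ (Fin 3)) | 1 * R < ‖x‖ ∧ ‖x‖ < L * R},
          ‖U x‖ₑ ^ (6 * (3 - δ) / (6 - δ))).toReal) ^ ((3 - δ) / (6 * (3 - δ) / (6 - δ))) := by
  have h6 : 0 < 6 - δ := by linarith
  have h3 : 0 < 3 - δ := by linarith
  have hq0 : 0 ≤ 6 * (3 - δ) / (6 - δ) := by positivity
  have hset : {x : (EuclideanSpace ℝ (Fin 3)) | 1 * R < ‖x‖ ∧ ‖x‖ < L * R} = {x : (EuclideanSpace ℝ (Fin 3)) | R < ‖x‖ ∧ ‖x‖ < L * R} := by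
    simp only [one_mul]
  have hEtop : ∫⁻ x in {x : (EuclideanSpace ℝ (Fin 3)) | R < ‖x‖ ∧ ‖x‖ < L * R}, ‖U x‖ₑ ^ (6 * (3 - δ) / (6 - δ)) < ⊤ :=
    setLIntegral_enorm_rpow_lt_top hU hq0 (fun x hx => mem_closedBall_zero_iff.2 hx.2.le)
  have he : (3 - δ) / (6 * (3 - δ) / (6 - δ)) = (6 - δ) / 6 := by field_simp
  unfold tsaiAnnulusQuantity
  refine ⟨ENNReal.mul_ne_top (ENNReal.inv_ne_top.2 ((ENNReal.ofReal_pos.2 hR).ne'))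
    (ENNReal.rpow_ne_top_of_nonneg (by positivity) hEtop.ne), ?_⟩
  rw [hset, he, ENNReal.toReal_mul, ENNReal.toReal_inv, ENNReal.toReal_ofReal hR.le, ← ENNReal.toReal_rpow]

/-- **Growth of Tsai's quantity for a nonzero constant field**: if `U ≡ b ≠ 0` then
`R⁻¹‖U‖^{3−δ}_{L^q(R<|x|<LR)} ≥ 1` for all large `R` (the annulus contains a ball of radius
`(L−1)R/2`, so the quantity is `≳ R^{(4−δ)/2}`). [cite: Tsai2021, proof of Thm 1.1 (last step: b = 0)] -/
theorem tsaiAnnulusQuantity_const_eventually_ge (hδ1 : δ ≤ 1) (hL : 1 < L) {b : (EuclideanSpace ℝ (Fin 3))}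
    (hb : b ≠ 0) : ∀ᶠ R in atTop, (1 : ℝ≥0∞) ≤ tsaiAnnulusQuantity δ L (fun _ => b) R := by
  have h6 : 0 < 6 - δ := by linarith
  have h3 : 0 < 3 - δ := by linarith
  generalize hq' : 6 * (3 - δ) / (6 - δ) = q
  have hq0 : 0 < q := by rw [← hq']; positivity
  set e : ℝ := (6 - δ) / 6 with he
  have he0 : 0 < e := by rw [he]; positivity
  have he1 : 3 * e - 1 ≥ 1 := by rw [he]; nlinarith
  -- the constants
  set r₀ : ℝ := (L - 1) / 2 with hr₀
  have hr₀0 : 0 < r₀ := by rw [hr₀]; linarith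
  set v₁ : ℝ := (volume (ball (0 : (EuclideanSpace ℝ (Fin 3))) 1)).toReal with hv₁
  have hv₁0 : 0 < v₁ := by
    rw [hv₁]; exact ENNReal.toReal_pos (measure_ball_pos volume (0 : (EuclideanSpace ℝ (Fin 3))) one_pos).ne' measure_ball_lt_top.ne
  set κ₁ : ℝ := ‖b‖ ^ q * (r₀ ^ 3 * v₁) with hκ₁
  have hb0 : 0 < ‖b‖ := norm_pos_iff.2 hb
  have hκ₁0 : 0 < κ₁ := by rw [hκ₁]; exact mul_pos (Real.rpow_pos_of_pos hb0 _) (by positivity)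
  have hκe : 0 < κ₁ ^ e := Real.rpow_pos_of_pos hκ₁0 _
  refine (eventually_ge_atTop (max 1 (κ₁ ^ e)⁻¹)).mono fun R hR => ?_
  have hR1 : 1 ≤ R := le_trans (le_max_left _ _) hR
  have hR0 : 0 < R := by linarith
  have hRκ : (κ₁ ^ e)⁻¹ ≤ R := le_trans (le_max_right _ _) hR
  -- the ball inside the annulus
  set x₀ : (EuclideanSpace ℝ (Fin 3)) := ((1 + L) / 2 * R) • EuclideanSpace.single (0 : Fin 3) (1 : ℝ) with hx₀
  have hx₀n : ‖x₀‖ = (1 + L) / 2 * R := by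
    rw [hx₀, norm_smul, Real.norm_of_nonneg (by positivity)]; simp
  have hball : ball x₀ (r₀ * R) ⊆ {x : (EuclideanSpace ℝ (Fin 3)) | R < ‖x‖ ∧ ‖x‖ < L * R} := by
    intro y hy
    rw [mem_ball, dist_eq_norm] at hy
    have h1 : ‖x₀‖ - ‖y - x₀‖ ≤ ‖y‖ := by
      have := norm_sub_norm_le x₀ (x₀ - y); rw [sub_sub_cancel, norm_sub_rev] at this; linarith
    have h2 : ‖y‖ ≤ ‖x₀‖ + ‖y - x₀‖ := by
      have := norm_add_le x₀ (y - x₀); rwa [add_sub_cancel] at this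
    rw [hx₀n] at h1 h2
    constructor
    · rw [hr₀] at hy; nlinarith
    · rw [hr₀] at hy; nlinarith
  -- lower bound of the quantity
  have hvol : ENNReal.ofReal (r₀ ^ 3 * v₁ * R ^ 3) ≤ volume {x : (EuclideanSpace ℝ (Fin 3)) | R < ‖x‖ ∧ ‖x‖ < L * R} := by
    refine le_trans (le_of_eq ?_) (measure_mono hball)
    rw [Measure.addHaar_ball_of_pos _ _ (by positivity), finrank_euclideanSpace_fin,
      show r₀ ^ 3 * v₁ * R ^ 3 = (r₀ * R) ^ 3 * v₁ by ring, ENNReal.ofReal_mul (by positivity), hv₁,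
      ENNReal.ofReal_toReal measure_ball_lt_top.ne]
  have hlin : ∫⁻ _ in {x : (EuclideanSpace ℝ (Fin 3)) | R < ‖x‖ ∧ ‖x‖ < L * R}, ‖b‖ₑ ^ q =
      ‖b‖ₑ ^ q * volume {x : (EuclideanSpace ℝ (Fin 3)) | R < ‖x‖ ∧ ‖x‖ < L * R} := by
    rw [setLIntegral_const]
  have hlow : ENNReal.ofReal (κ₁ * R ^ 3) ≤ ∫⁻ _ in {x : (EuclideanSpace ℝ (Fin 3)) | R < ‖x‖ ∧ ‖x‖ < L * R}, ‖b‖ₑ ^ q := by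
    rw [hlin, hκ₁, show ‖b‖ ^ q * (r₀ ^ 3 * v₁) * R ^ 3 = ‖b‖ ^ q * (r₀ ^ 3 * v₁ * R ^ 3) by ring,
      ENNReal.ofReal_mul (by positivity), ← ofReal_norm, ENNReal.ofReal_rpow_of_nonneg (norm_nonneg _) hq0.le]
    gcongr
  have hreal : 1 ≤ R⁻¹ * (κ₁ * R ^ 3) ^ e := by
    have h1 : (κ₁ * R ^ 3) ^ e = κ₁ ^ e * R ^ (3 * e) := by
      rw [Real.mul_rpow hκ₁0.le (by positivity), show (R ^ 3 : ℝ) = R ^ (3 : ℝ) by norm_cast,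
        ← Real.rpow_mul hR0.le]
    have h2 : R⁻¹ * R ^ (3 * e) = R ^ (3 * e - 1) := by
      rw [← Real.rpow_neg_one R, ← Real.rpow_add hR0]; congr 1; ring
    have h3 : R ≤ R ^ (3 * e - 1) := by
      conv_lhs => rw [← Real.rpow_one R]
      exact Real.rpow_le_rpow_of_exponent_le hR1 he1
    have h4 : 1 ≤ κ₁ ^ e * R := by
      have := mul_le_mul_of_nonneg_left hRκ hκe.le
      rwa [mul_inv_cancel₀ hκe.ne'] at this
    calc (1 : ℝ) ≤ κ₁ ^ e * R := h4
      _ ≤ κ₁ ^ e * R ^ (3 * e - 1) := mul_le_mul_of_nonneg_left h3 hκe.le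
      _ = R⁻¹ * (κ₁ * R ^ 3) ^ e := by rw [h1, ← h2]; ring
  unfold tsaiAnnulusQuantity
  rw [hq']
  calc (1 : ℝ≥0∞) = ENNReal.ofReal 1 := ENNReal.ofReal_one.symm
    _ ≤ ENNReal.ofReal (R⁻¹ * (κ₁ * R ^ 3) ^ e) := ENNReal.ofReal_le_ofReal hreal
    _ = (ENNReal.ofReal R)⁻¹ * ENNReal.ofReal (κ₁ * R ^ 3) ^ e := by
        rw [ENNReal.ofReal_mul (inv_nonneg.2 hR0.le), ENNReal.ofReal_inv_of_pos hR0,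
          ENNReal.ofReal_rpow_of_nonneg (by positivity) he0.le]
    _ ≤ (ENNReal.ofReal R)⁻¹ * (∫⁻ _ in {x : (EuclideanSpace ℝ (Fin 3)) | R < ‖x‖ ∧ ‖x‖ < L * R}, ‖b‖ₑ ^ q) ^ e := by
        gcongr

end Quantity

/-! ### §16. Proof of Theorem 1.1 (a) -/

section Final

variable {ν δ L : ℝ} {U : (EuclideanSpace ℝ (Fin 3)) → (EuclideanSpace ℝ (Fin 3))} {P : (EuclideanSpace ℝ (Fin 3)) → ℝ}

/-- **The Dirichlet integral vanishes on every ball** under the hypotheses of Theorem 1.1 (a):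
along radii `R_k → ∞` with `Q(R_k) → 0`, (3.7)–(3.8) give `∫_{B_ρ} |DU|² ≤ ∫ ζ_k² |DU|² ≤ C Ψ(Q(R_k)) → 0`.
[cite: Tsai2021, Thm 1.1 (a), §3 (3.6)–(3.8)] -/
theorem setIntegral_frobenius_ball_eq_zero (hν : 0 < ν) (hδ0 : 0 ≤ δ) (hδ1 : δ ≤ 1) (hL : 1 < L)
    (hprof : IsLerayProfile ν 0 U P) (hlim : liminf (tsaiAnnulusQuantity δ L U) atTop = 0)
    (ρ : ℝ) : ∫ x in ball (0 : (EuclideanSpace ℝ (Fin 3))) ρ, frobeniusNormSq (fderiv ℝ U x) = 0 := by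
  have hU : ContDiff ℝ ∞ U := hprof.contDiff_velocity_infty hν.ne' (by simp)
  have hU1 : ContDiff ℝ 1 U := hU.of_le (by norm_cast)
  have h6 : 0 < 6 - δ := by linarith
  have h3 : 0 < 3 - δ := by linarith
  have h2 : 0 < 2 - δ := by linarith
  -- geometry `1 < a < b < L` and the cut-off family
  obtain ⟨a, b, h1a, hab, hbL⟩ : ∃ a b : ℝ, 1 < a ∧ a < b ∧ b < L :=
    ⟨1 + (L - 1) / 3, 1 + 2 * (L - 1) / 3, by linarith, by linarith, by linarith⟩
  have ha0 : 0 < a := by linarith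
  obtain ⟨K, hK0, hζfam⟩ := exists_cutoff_family ha0 hab
  -- the pressure constant and the energy estimate
  have hs1 : 1 < 3 * (3 - δ) / (6 - δ) := by rw [lt_div_iff₀ h6]; nlinarith
  have hp1 : (1 : ℝ≥0∞) < ENNReal.ofReal (3 * (3 - δ) / (6 - δ)) := by
    rw [← ENNReal.ofReal_one]; exact (ENNReal.ofReal_lt_ofReal_iff (by linarith)).2 hs1
  obtain ⟨Cp, hCp⟩ := pressure_osc_shell_scaled (p := ENNReal.ofReal (3 * (3 - δ) / (6 - δ))) hν hp1
    ENNReal.ofReal_lt_top one_pos h1a hab.le hbL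
  obtain ⟨C, hC⟩ := energy_estimate hν hδ0 hδ1 hprof hU h1a hab hbL hK0 Cp
  -- the modulus `Ψ`
  obtain ⟨Ψ, hΨ⟩ : ∃ Ψ : ℝ → ℝ, ∀ t, Ψ t =
      t ^ (2 / (3 - δ)) + (t + t ^ ((2 - δ) / (3 - δ))) ^ (2 / (2 - δ)) := ⟨_, fun t => rfl⟩
  have hΨc : Continuous Ψ := by
    rw [show Ψ = fun t => t ^ (2 / (3 - δ)) + (t + t ^ ((2 - δ) / (3 - δ))) ^ (2 / (2 - δ)) from funext hΨ]
    have hc1 : Continuous fun t : ℝ => t ^ (2 / (3 - δ)) := Real.continuous_rpow_const (by positivity)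
    have hc2 : Continuous fun t : ℝ => t ^ ((2 - δ) / (3 - δ)) :=
      Real.continuous_rpow_const (div_nonneg h2.le h3.le)
    exact hc1.add ((continuous_id.add hc2).rpow_const fun _ => Or.inr (by positivity))
  have hΨ0 : Ψ 0 = 0 := by
    rw [hΨ, Real.zero_rpow (by positivity : 2 / (3 - δ) ≠ 0),
      Real.zero_rpow (ne_of_gt (div_pos h2 h3)), add_zero, Real.zero_rpow (by positivity : 2 / (2 - δ) ≠ 0),
      add_zero]
  have hΨt : Tendsto (fun t => C * Ψ t) (𝓝 0) (𝓝 0) := by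
    have h := (hΨc.tendsto 0).const_mul C
    rwa [hΨ0, mul_zero] at h
  -- the key inequality along every admissible radius
  have hkey : ∀ R : ℝ, 1 ≤ R → ρ ≤ a * R →
      (∫ x in ball (0 : (EuclideanSpace ℝ (Fin 3))) ρ, frobeniusNormSq (fderiv ℝ U x)) ≤
        C * Ψ ((tsaiAnnulusQuantity δ L U R).toReal) := by
    intro R hR1 hρR
    have hR0 : 0 < R := by linarith
    obtain ⟨ζ, hζs, hζc, hζ01, hζ1, hζ0, hζD, hζΔ, hζsupp⟩ := hζfam R hR0
    obtain ⟨c, hc⟩ := hCp R hR0 U P hprof hU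
    have hE := hC R hR1 ζ hζs hζc hζ01 hζ0 hζD hζΔ hζsupp c hc
    rw [hΨ, (tsaiAnnulusQuantity_toReal hδ1 hU.continuous hR0).2]
    refine le_trans ?_ hE
    have hcont : Continuous fun x => ζ x ^ 2 * frobeniusNormSq (fderiv ℝ U x) := by
      refine (hζs.continuous.pow 2).mul ?_
      have h := (hU1.continuous_fderiv one_ne_zero)
      simp only [frobeniusNormSq]
      exact continuous_finsetSum _ fun i _ => (h.clm_apply continuous_const).norm.pow 2
    have hcs : HasCompactSupport fun x => ζ x ^ 2 * frobeniusNormSq (fderiv ℝ U x) := by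
      have : HasCompactSupport fun x => ζ x ^ 2 := by
        have h : HasCompactSupport fun y => ζ y * ζ y := hζc.mul_right
        simpa only [sq] using h
      exact this.mul_right
    calc (∫ x in ball (0 : (EuclideanSpace ℝ (Fin 3))) ρ, frobeniusNormSq (fderiv ℝ U x))
        = ∫ x in ball (0 : (EuclideanSpace ℝ (Fin 3))) ρ, ζ x ^ 2 * frobeniusNormSq (fderiv ℝ U x) := by
          refine setIntegral_congr_fun measurableSet_ball fun x hx => ?_
          rw [mem_ball_zero_iff] at hx
          rw [hζ1 x (by linarith), one_pow, one_mul]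
      _ ≤ ∫ x, ζ x ^ 2 * frobeniusNormSq (fderiv ℝ U x) :=
          setIntegral_le_integral (hcont.integrable_of_hasCompactSupport hcs)
            (Eventually.of_forall fun x => mul_nonneg (sq_nonneg _) (frobeniusNormSq_nonneg _))
  -- conclusion: the ball integral is `≤ C Ψ(Q(R))` for radii with `Q(R)` arbitrarily small
  have hI0 : 0 ≤ ∫ x in ball (0 : (EuclideanSpace ℝ (Fin 3))) ρ, frobeniusNormSq (fderiv ℝ U x) :=
    integral_nonneg fun x => frobeniusNormSq_nonneg _
  by_contra hne
  have hIpos : 0 < ∫ x in ball (0 : (EuclideanSpace ℝ (Fin 3))) ρ, frobeniusNormSq (fderiv ℝ U x) :=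
    lt_of_le_of_ne hI0 (Ne.symm hne)
  obtain ⟨η, hη0, hη⟩ := Metric.eventually_nhds_iff.1 (hΨt.eventually (eventually_lt_nhds hIpos))
  have hfreq : ∃ᶠ R in atTop, tsaiAnnulusQuantity δ L U R < ENNReal.ofReal η :=
    frequently_lt_of_liminf_lt (by isBoundedDefault) (by rw [hlim]; exact ENNReal.ofReal_pos.2 hη0)
  obtain ⟨R, hRlt, hRge⟩ := (hfreq.and_eventually (eventually_ge_atTop (max 1 (ρ / a)))).exists
  have hR1 : 1 ≤ R := le_trans (le_max_left _ _) hRge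
  have hρR : ρ ≤ a * R := by
    have h := le_trans (le_max_right _ _) hRge
    rw [div_le_iff₀ ha0] at h
    linarith
  have h1 := hkey R hR1 hρR
  have h2 : C * Ψ ((tsaiAnnulusQuantity δ L U R).toReal) <
      ∫ x in ball (0 : (EuclideanSpace ℝ (Fin 3))) ρ, frobeniusNormSq (fderiv ℝ U x) := by
    apply hη
    rw [dist_zero_right, Real.norm_of_nonneg ENNReal.toReal_nonneg]
    exact ENNReal.toReal_lt_of_lt_ofReal hRlt
  linarith

end Final

end Tsai2021

open Tsai2021 in
/-- **Tsai 2021, Theorem 1.1 (a)** (`q < 3`, i.e. `0 ≤ δ ≤ 1`), discharging the tree's named fact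
`Tsai2021_annular_liouville`: a smooth steady Navier–Stokes solution in `EuclideanSpace ℝ (Fin 3)` with
`liminf_{R→∞} R⁻¹ ‖U‖^{3−δ}_{L^q(R<|x|<LR)} = 0`, `q = 6(3−δ)/(6−δ)`, vanishes identically.
Proof as printed in §3: local pressure-free estimate on the shells (here via the truncated Green
representation and Calderón–Zygmund, `SteadyLiouvilleTsaiKit/Vorticity/Pressure`), the energy
identity tested with `ζ²`, Hölder + Sobolev + Young ((3.6)–(3.8)), whence `∫|DU|² = 0`, `U` is
constant, and the hypothesis forces the constant to be `0`.
[cite: Tsai2021, Thm 1.1 (a); arXiv:2005.09691, §3] -/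
theorem Tsai2021_annular_liouville_holds : Tsai2021_annular_liouville := by
  intro ν hν U P hprof δ L hδ0 hδ1 hL hlim
  have hU : ContDiff ℝ ∞ U := hprof.contDiff_velocity_infty hν.ne' (by simp)
  have hU1 : ContDiff ℝ 1 U := hU.of_le (by norm_cast)
  have hball0 : ∀ ρ : ℝ, 0 < ρ → ∫ x in ball (0 : (EuclideanSpace ℝ (Fin 3))) ρ, frobeniusNormSq (fderiv ℝ U x) = 0 :=
    fun ρ _ => setIntegral_frobenius_ball_eq_zero hν hδ0 hδ1 hL hprof hlim ρ
  -- `|DU|²_F ≡ 0`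
  have hfc : Continuous fun x => frobeniusNormSq (fderiv ℝ U x) := by
    have h := (hU1.continuous_fderiv one_ne_zero)
    simp only [frobeniusNormSq]
    exact continuous_finsetSum _ fun i _ => (h.clm_apply continuous_const).norm.pow 2
  have hf0 : ∀ x, 0 ≤ frobeniusNormSq (fderiv ℝ U x) := fun x => frobeniusNormSq_nonneg _
  have hfi : ∀ r : ℝ, IntegrableOn (fun x => frobeniusNormSq (fderiv ℝ U x)) (ball (0 : (EuclideanSpace ℝ (Fin 3))) r) volume :=
    fun r => (hfc.continuousOn.integrableOn_compact (isCompact_closedBall 0 r)).mono_set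
      ball_subset_closedBall
  have hfzero : (fun x => frobeniusNormSq (fderiv ℝ U x)) = fun _ => 0 := by
    have hae : ∀ n : ℕ, ∀ᵐ x ∂(volume.restrict (ball (0 : (EuclideanSpace ℝ (Fin 3))) (n + 1))),
        frobeniusNormSq (fderiv ℝ U x) = 0 := fun n =>
      (setIntegral_eq_zero_iff_of_nonneg_ae (ae_of_all _ hf0) (hfi _)).1 (hball0 (n + 1) (by positivity))
    have hae' : ∀ᵐ x ∂(volume : Measure (EuclideanSpace ℝ (Fin 3))), frobeniusNormSq (fderiv ℝ U x) = (fun _ => (0 : ℝ)) x := by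
      have h := (ae_restrict_iUnion_iff (fun n : ℕ => ball (0 : (EuclideanSpace ℝ (Fin 3))) (n + 1))
        (fun x => frobeniusNormSq (fderiv ℝ U x) = 0)).2 hae
      rwa [iUnion_ball_nat_succ, Measure.restrict_univ] at h
    exact Measure.eq_of_ae_eq hae' hfc continuous_const
  -- `DU ≡ 0`, so `U` is a constant `b`
  have hDU : ∀ x, fderiv ℝ U x = 0 := fun x => by
    have h1 : frobeniusNormSq (fderiv ℝ U x) = 0 := congrFun hfzero x
    have h2 := opNorm_sq_le_frobeniusNormSq_fin3 (fderiv ℝ U x)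
    rw [h1] at h2
    have h3 : ‖fderiv ℝ U x‖ = 0 := by nlinarith [norm_nonneg (fderiv ℝ U x)]
    exact norm_eq_zero.1 h3
  have hconst : ∀ x, U x = U 0 := fun x =>
    is_const_of_fderiv_eq_zero (hU1.differentiable one_ne_zero) hDU x 0
  -- a nonzero constant violates `liminf Q(R) = 0`
  by_contra hne
  have hb : U 0 ≠ 0 := fun h => hne (funext fun x => by rw [hconst x, h]; rfl)
  have hUeq : U = fun _ => U 0 := funext hconst
  have hev : ∀ᶠ R in atTop, (1 : ℝ≥0∞) ≤ tsaiAnnulusQuantity δ L U R := by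
    rw [hUeq]; exact tsaiAnnulusQuantity_const_eventually_ge hδ1 hL hb
  have h1 : (1 : ℝ≥0∞) ≤ liminf (tsaiAnnulusQuantity δ L U) atTop := le_liminf_of_le (by isBoundedDefault) hev
  rw [hlim] at h1
  exact absurd h1 (by simp)

end Literature.Analysis.FluidPDE

end
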